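import Literature.Analysis.FluidPDE.NewtonKernel
import Literature.Analysis.FluidPDE.NormalisedPressureCompactSupport
import Literature.Analysis.FluidPDE.NormalisedPressureL2Finite
import Literature.Analysis.FluidPDE.NormalisedPressureDuality
import Literature.Analysis.FluidPDE.NormalisedPressureAffine
import Literature.Analysis.FluidPDE.LerayHopf
import HarnessLib

/-!
# One-sided pressure bounds force Type I: the monotonicity of the scaled kinetic energy

Analysis/FluidPDE proofs file (theorems only; no definitions, no named facts), serving the
named fact `Literature.Analysis.FluidPDE.seregin_sverak_2002` (`SereginSverakPressure.lean`;
G. Seregin, V. Šverák, *Navier–Stokes equations with lower bounds on the pressure*,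
Arch. Ration. Mech. Anal. **163** (2002) 65–86 — cite-only on this hub, acquisition `acq-01580`).
It isolates and PROVES the kinematic mechanism by which the two printed one-sided hypotheses —
a floor `p̃ ≥ -K` for the normalised pressure `p̃ = -Δ⁻¹∂ᵢ∂ⱼ(uᵢuⱼ)`, or a ceiling
`|u|²/2 + p̃ ≤ K` for the Bernoulli head — control the velocity: they make a smoothed version of
the scaled kinetic energy `s⁻¹ ∫_{B(x₀,s)} |u|²` (Seregin's quantity `A`) almost MONOTONE in the
scale `s`, at every centre and every time, whence a UNIFORM TYPE I BOUND
(`scaledKineticEnergy_le_of_oneSided_pressure`):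

  `r⁻¹ ∫_{B(x₀, r/2)} |u(t)|² ≤ S⁻¹ ‖u(0)‖₂² + 4πK S²`  for all `x₀`, `t ∈ (0, T)`, `0 < r ≤ S`.

The endgame of the printed theorem (from Type I plus the sign structure to boundedness at the
final time, §4 of the paper, resp. its `A`-criterion Lemma 3.3) is NOT in this file. The sibling
tree file `SereginSverakPressureTypeI.lean` (another seat, same fact) reaches the Type I bound for
a.e. time by a fixed-time elliptic estimate with Newtonian-tail test functions; the present file
is the monotonicity route, whose extra output is the DOWNWARD MONOTONICITY of the probe-smoothed
scaled energy (`scaledEnergy_le_of_oneSided`: `F(r) ≤ F(S) + (3/2) M c_P (S² - r²)` for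
`r ≤ S`), the form in which smallness of `A` at one scale propagates to all smaller scales (the
input of the `A`-criterion). The two files share no declarations (this one was first accepted as
p56947 under the sibling's path and is re-landed here unchanged under its own name).

## The mechanism

For a field `w : ℝ³ → ℝ³` and a radial probe `ψ(x) = P(|x - x₀|²)` with MEAN profile `P̄`
(`P̄(|x|²)` = mean of `ψ` over the ball `|y| ≤ |x|`, i.e. the ODE `P̄ + (2/3)σP̄' = P` in
`σ = |x|²`; a **probe pair** is such a pair of smooth profiles with `P` supported in `σ ≤ 1`,
`P = P̄ = 1` on `σ ≤ 1/4`, `0 ≤ P ≤ P̄ ≤ 1`, `P̄' ≤ 0`), the Hessian of the Newtonian potential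
of the radial mass `ψ dx` is explicit (Newton's theorem), and testing the pressure Poisson
equation `-Δp̃ = ∂ᵢ∂ⱼ(wᵢwⱼ)` against that potential gives the **pressure–probe identity**
(Parts B–C)

  `∫ p̃[w] P(|x-x₀|²) dx = -∫ ( (2/3) P̄'(|x-x₀|²) ⟨x-x₀, w⟩² + (1/3) P̄(|x-x₀|²) |w|² ) dx`

(for the indicator of a ball: `∫_{B_R} p̃ = -(1/3)∫_{B_R}|w|² + (R³/3)∫_{|x|>R}(3w_ρ² - |w|²)|x|⁻³`).
With the scale family `P_s = P(·/s²)` and `F(s) = ∫ |w|² s⁻¹ P̄(|x-x₀|²/s²)` one gets the exact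
formula (Part D) `F(S) - F(r) = ∫_r^S s⁻² G(s) ds`,
`G(s) = ∫|w|²(2P̄ - 3P)_s = 3∫ p̃ P_s + 2∫(-P̄')_s s⁻²(|x-x₀|²|w|² - ⟨x-x₀,w⟩²) ≥ 3∫ p̃ P_s`, so a
floor `p̃ ≥ -M` on `B(x₀, S)` gives `G(s) ≥ -3M s³ c_P`, and (by the same identity, with the radial
instead of the tangential component in the coercive term) so does a head ceiling
`|w|² + 2p̃ ≤ M`; hence `F(r) ≤ F(S) + (3/2)M c_P(S² - r²)` and
`r⁻¹∫_{B(x₀,r/2)}|w|² ≤ F(r) ≤ S⁻¹‖w‖₂² + (3/2)M c_P S²`.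

## Contents (namespace `Literature.Analysis.FluidPDE.SereginSverak2002`)

* Part A `exists_pressureProbePair` — a smooth probe pair (`Y = cutoffProfile ½ 1`,
  `q = (1-Y)/σ`, `Q = ∫₀^σ q`, `P̄ = exp(-3Q/2)`, `P = Y P̄`: the ODE holds identically).
* Part B `integral_normalisedPressure_mul_probe_of_hasCompactSupport` — the identity for
  `w ∈ C_c^∞` (weak Poisson equation `integral_normalisedPressure_mul_laplacian` against the
  radial test function `h_L(|x|²)`, `h_L' = -(1/6)P̄·X(·/L²)`, error `O(L⁻³)` → 0).
* Part C `integral_normalisedPressure_mul_probe`, `…_scaled` — `w ∈ C^∞` of finite energy, every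
  centre and scale (cut-off approximation, `tendsto_normalisedPressure_cutoff`; affine covariance
  `normalisedPressure_comp_affine`).
* Part D `scaledEnergy_sub_eq_integral` (Fubini), `three_mul_integral_pressure_probe_le`,
  `G_lower_bound_of_floor`, `G_lower_bound_of_head`, `scaledEnergy_le_of_oneSided`,
  `typeI_of_oneSided`.
* Part E `scaledKineticEnergy_le_of_oneSided_pressure` (and the `A(z₀, ρ)` form `…'`) for the
  classes of `seregin_sverak_2002` (`IsClassicalNSSolutionOn (Ico 0 T) ν 0 u p`,
  `IsLerayHopfOn T ν 0 (u 0) u`): energy inequality and `c_P ≤ 4π/3`.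

Everything is proved; axioms `propext`, `Classical.choice`, `Quot.sound`.

## References

* G. Seregin, V. Šverák, Arch. Ration. Mech. Anal. 163 (2002) 65–86: main theorem (abstract),
  hypotheses `p ≥ -g` / `|v|²/2 + p ≤ g`; Lemma 3.3 (the `A`-criterion). [SereginSverak2002]
* G. Seregin, *Estimates of suitable weak solutions to the Navier–Stokes equations in critical
  Morrey spaces*, arXiv:math/0607537, Lemma 2.1 (c) (the quantity `A`). [Seregin2006]
* T. Tao, Anal. PDE 6 (2013), (35), (42): the normalised pressure. [Tao2011]
* D. Gilbarg, N. Trudinger, *Elliptic PDE of second order*, (2.11)–(2.13), Lemma 4.2 (radial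
  Laplacian, Newtonian potential). [GilbargTrudinger2001]
-/

noncomputable section

open MeasureTheory Set Filter Metric Topology Function Real
open scoped ENNReal NNReal RealInnerProductSpace ContDiff Laplacian

namespace Literature.Analysis.FluidPDE

namespace SereginSverak2002

/-! ## Part A. A smooth probe pair -/

section ProbePair

/-- The cutoff profile `Y = Θ_{1/2,1}` is `1` on `σ ≤ 1/4`. [folklore] -/
theorem cutoffProfile_half_one_eq_one {σ : ℝ} (hσ : σ ≤ 1 / 4) : cutoffProfile (1 / 2) 1 σ = 1 :=
  cutoffProfile_eq_one (by norm_num) (by norm_num) (by norm_num; linarith)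

/-- The cutoff profile `Y = Θ_{1/2,1}` vanishes on `σ ≥ 1`. [folklore] -/
theorem cutoffProfile_half_one_eq_zero {σ : ℝ} (hσ : 1 ≤ σ) : cutoffProfile (1 / 2) 1 σ = 0 :=
  cutoffProfile_eq_zero (by norm_num) (by norm_num) (by norm_num; linarith)

/-- The cutoff profile `Y = Θ_{1/2,1}` is non-increasing. [folklore] -/
theorem cutoffProfile_half_one_antitone : Antitone (cutoffProfile (1 / 2) 1) := by
  intro a b hab
  unfold cutoffProfile
  refine Real.smoothTransition.monotone ?_
  have h : (0 : ℝ) < 1 ^ 2 - (1 / 2) ^ 2 := by norm_num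
  exact div_le_div_of_nonneg_right (by linarith) h.le

/-- **A smooth probe pair exists.** There are smooth `P, P̄ : ℝ → ℝ` with `0 ≤ P ≤ P̄ ≤ 1`,
`0 < P̄`, `P = P̄ = 1` on `σ ≤ 1/4`, `P = 0` on `σ ≥ 1`, `P̄' ≤ 0`, and the mean-profile ODE
`P̄(σ) + (2/3) σ P̄'(σ) = P(σ)` for every `σ`. Construction: `Y = cutoffProfile ½ 1`,
`q = (1 - Y)/σ` (smooth: it vanishes identically near `σ ≤ 1/4`), `Q(σ) = ∫₀^σ q`,
`P̄ = exp(-3Q/2)`, `P = Y P̄`; then `σ q = 1 - Y` gives the ODE. [folklore] -/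
theorem exists_pressureProbePair :
    ∃ P Pb : ℝ → ℝ, ContDiff ℝ ∞ P ∧ ContDiff ℝ ∞ Pb ∧
      (∀ σ, 0 ≤ P σ) ∧ (∀ σ, P σ ≤ Pb σ) ∧ (∀ σ, Pb σ ≤ 1) ∧ (∀ σ, 0 < Pb σ) ∧
      (∀ σ, σ ≤ 1 / 4 → P σ = 1) ∧ (∀ σ, σ ≤ 1 / 4 → Pb σ = 1) ∧ (∀ σ, 1 ≤ σ → P σ = 0) ∧
      (∀ σ, deriv Pb σ ≤ 0) ∧
      (∀ σ, Pb σ + 2 / 3 * σ * deriv Pb σ = P σ) := by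
  set Y : ℝ → ℝ := cutoffProfile (1 / 2) 1 with hYdef
  have hY : ContDiff ℝ ∞ Y := cutoffProfile_contDiff _ _
  have hY1 : ∀ σ, σ ≤ 1 / 4 → Y σ = 1 := fun σ hσ => cutoffProfile_half_one_eq_one hσ
  have hY0 : ∀ σ, 1 ≤ σ → Y σ = 0 := fun σ hσ => cutoffProfile_half_one_eq_zero hσ
  have hYnn : ∀ σ, 0 ≤ Y σ := fun σ => cutoffProfile_nonneg _ _ _
  have hYle : ∀ σ, Y σ ≤ 1 := fun σ => cutoffProfile_le_one _ _ _
  -- `q = (1 - Y)/σ`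
  set q : ℝ → ℝ := fun σ => (1 - Y σ) / σ with hqdef
  have hq0 : ∀ σ, σ ≤ 1 / 4 → q σ = 0 := fun σ hσ => by
    simp only [hqdef, hY1 σ hσ, sub_self, zero_div]
  have hq : ContDiff ℝ ∞ q := by
    refine contDiff_iff_contDiffAt.2 fun σ => ?_
    by_cases hσ : σ < 1 / 4
    · have heq : (fun _ : ℝ => (0 : ℝ)) =ᶠ[𝓝 σ] q := by
        filter_upwards [Iio_mem_nhds hσ] with τ hτ
        exact (hq0 τ (le_of_lt hτ)).symm
      exact contDiffAt_const.congr_of_eventuallyEq heq.symm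
    · have hσ0 : σ ≠ 0 := by intro h; rw [h] at hσ; norm_num at hσ
      exact (contDiffAt_const.sub hY.contDiffAt).div contDiffAt_id hσ0
  have hqnn : ∀ σ, 0 ≤ q σ := fun σ => by
    by_cases hσ : σ ≤ 1 / 4
    · rw [hq0 σ hσ]
    · push Not at hσ
      exact div_nonneg (by linarith [hYle σ]) (by linarith)
  have hσq : ∀ σ, σ * q σ = 1 - Y σ := fun σ => by
    by_cases hσ : σ = 0
    · rw [hσ, zero_mul, hY1 0 (by norm_num), sub_self]
    · simp only [hqdef]
      exact mul_div_cancel₀ _ hσ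
  -- `Q = ∫₀^σ q`
  set Q : ℝ → ℝ := fun σ => ∫ u in (0 : ℝ)..σ, q u with hQdef
  have hQderiv : ∀ σ, HasDerivAt Q (q σ) σ := fun σ =>
    intervalIntegral.integral_hasDerivAt_right (hq.continuous.intervalIntegrable _ _)
      (hq.continuous.stronglyMeasurableAtFilter _ _) hq.continuous.continuousAt
  have hQdiff : Differentiable ℝ Q := fun σ => (hQderiv σ).differentiableAt
  have hQd : deriv Q = q := funext fun σ => (hQderiv σ).deriv
  have hQ : ContDiff ℝ ∞ Q := contDiff_infty_iff_deriv.2 ⟨hQdiff, by rw [hQd]; exact hq⟩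
  have hQ0 : ∀ σ, σ ≤ 1 / 4 → Q σ = 0 := fun σ hσ => by
    simp only [hQdef]
    refine intervalIntegral.integral_zero_ae (Eventually.of_forall fun u hu => ?_)
    refine hq0 u ?_
    rcases le_total 0 σ with h | h
    · rw [uIoc_of_le h] at hu
      exact hu.2.trans hσ
    · rw [uIoc_of_ge h] at hu
      linarith [hu.2]
  have hQnn : ∀ σ, 0 ≤ Q σ := fun σ => by
    rcases le_total 0 σ with h | h
    · exact intervalIntegral.integral_nonneg h fun u _ => hqnn u
    · rw [hQ0 σ (h.trans (by norm_num))]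
  -- `P̄ = exp(-3Q/2)`, `P = Y P̄`
  set Pb : ℝ → ℝ := fun σ => Real.exp (-(3 / 2) * Q σ) with hPbdef
  have hPb : ContDiff ℝ ∞ Pb := Real.contDiff_exp.comp (contDiff_const.mul hQ)
  have hPbpos : ∀ σ, 0 < Pb σ := fun σ => Real.exp_pos _
  have hPble : ∀ σ, Pb σ ≤ 1 := fun σ => by
    simp only [hPbdef]
    rw [Real.exp_le_one_iff]
    have := hQnn σ
    nlinarith
  have hPb1 : ∀ σ, σ ≤ 1 / 4 → Pb σ = 1 := fun σ hσ => by
    simp only [hPbdef, hQ0 σ hσ, mul_zero, Real.exp_zero]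
  have hPbderiv : ∀ σ, HasDerivAt Pb (Pb σ * (-(3 / 2) * q σ)) σ := fun σ => by
    have h := ((hQderiv σ).const_mul (-(3 / 2 : ℝ))).exp
    simpa only [hPbdef] using h
  have hPbd : ∀ σ, deriv Pb σ = Pb σ * (-(3 / 2) * q σ) := fun σ => (hPbderiv σ).deriv
  set P : ℝ → ℝ := fun σ => Y σ * Pb σ with hPdef
  refine ⟨P, Pb, hY.mul hPb, hPb, fun σ => mul_nonneg (hYnn σ) (hPbpos σ).le,
    fun σ => ?_, hPble, hPbpos, fun σ hσ => ?_, hPb1, fun σ hσ => ?_, fun σ => ?_, fun σ => ?_⟩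
  · simp only [hPdef]
    exact mul_le_of_le_one_left (hPbpos σ).le (hYle σ)
  · simp only [hPdef, hY1 σ hσ, hPb1 σ hσ, mul_one]
  · simp only [hPdef, hY0 σ hσ, zero_mul]
  · rw [hPbd]
    have := hPbpos σ
    have := hqnn σ
    nlinarith
  · rw [hPbd]
    simp only [hPdef]
    have h := hσq σ
    calc Pb σ + 2 / 3 * σ * (Pb σ * (-(3 / 2) * q σ)) = Pb σ * (1 - σ * q σ) := by ring
      _ = Y σ * Pb σ := by rw [h]; ring

end ProbePair


/-! ## Part B. The pressure–probe identity for compactly supported smooth fields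

For a probe pair `(P, P̄)` and `w ∈ C_c^∞(ℝ³; ℝ³)`,

  `∫ p̃[w](x) P(|x|²) dx = -∫ ( (2/3) P̄'(|x|²) ⟨x, w(x)⟩² + (1/3) P̄(|x|²) |w(x)|² ) dx`.

Proof: the weak pressure Poisson equation `-∫ p̃ Δφ = ∫ D²φ(w, w)`
(`integral_normalisedPressure_mul_laplacian`) with the radial test function `φ_L = h_L(|x|²)`,
`h_L' = -(1/6) P̄ · X(·/L²)` (`X = cutoffProfile 1 2`): by the ODE, `Δφ_L = -P(|x|²) - E_L`
with an error `E_L` supported in `L ≤ |x| ≤ 2L` of size `O(L⁻³)` (the decay `P̄(σ)² σ³ = const`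
for `σ ≥ 1`, again from the ODE), while `D²φ_L(a, a) = -(2/3)P̄'⟨x,a⟩² - (1/3)P̄|a|²` on the
support of `w` once `L` is large; the decay `|p̃[w](x)| ≤ C(1+|x|)⁻³` kills `∫ p̃ E_L` as
`L → ∞`. -/

section Identity

variable {P Pb : ℝ → ℝ}

/-- **Decay of the mean profile from the ODE**: if `P̄ + (2/3)σP̄' = P` and `P = 0` on `σ ≥ 1`,
then `P̄(σ)² σ³` is constant on `σ ≥ 1` (`(P̄²σ³)' = 3σ²P̄(P̄ + (2/3)σP̄') = 0`). [folklore] -/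
theorem probe_sq_mul_cube_eq (hPb : Differentiable ℝ Pb)
    (hode : ∀ σ, Pb σ + 2 / 3 * σ * deriv Pb σ = P σ) (hP0 : ∀ σ, 1 ≤ σ → P σ = 0)
    {σ : ℝ} (hσ : 1 ≤ σ) : Pb σ ^ 2 * σ ^ 3 = Pb 1 ^ 2 := by
  rcases eq_or_lt_of_le hσ with rfl | hlt
  · simp
  set f : ℝ → ℝ := fun τ => Pb τ ^ 2 * τ ^ 3 with hf
  set f' : ℝ → ℝ := fun τ => 3 * τ ^ 2 * Pb τ * (Pb τ + 2 / 3 * τ * deriv Pb τ) with hf'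
  have hderiv : ∀ τ, HasDerivAt f (f' τ) τ := fun τ => by
    have h1 : HasDerivAt (fun τ => Pb τ ^ 2) ((2 : ℕ) * Pb τ ^ (2 - 1) * deriv Pb τ) τ :=
      (hPb τ).hasDerivAt.fun_pow 2
    have h2 : HasDerivAt (fun τ : ℝ => τ ^ 3) ((3 : ℕ) * τ ^ (3 - 1) * 1) τ :=
      (hasDerivAt_id τ).fun_pow 3
    refine (h1.mul h2).congr_deriv ?_
    simp only [hf']
    push_cast
    ring
  obtain ⟨c, hc, hcf⟩ := exists_hasDerivAt_eq_slope f f' hlt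
    (fun τ _ => (hderiv τ).continuousAt.continuousWithinAt) (fun τ _ => hderiv τ)
  have hc0 : f' c = 0 := by
    simp only [hf', hode c, hP0 c hc.1.le, mul_zero]
  rw [hc0, eq_comm, div_eq_zero_iff, sub_eq_zero] at hcf
  rcases hcf with h | h
  · simpa [hf] using h
  · linarith [hc.1, hc.2]

/-- Consequently `P̄(σ) ≤ L⁻³` for `σ ≥ L²`, `L ≥ 1` (with `0 ≤ P̄ ≤ 1`). [folklore] -/
theorem probe_le_inv_cube (hPb : Differentiable ℝ Pb)
    (hode : ∀ σ, Pb σ + 2 / 3 * σ * deriv Pb σ = P σ) (hP0 : ∀ σ, 1 ≤ σ → P σ = 0)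
    (hPbnn : ∀ σ, 0 ≤ Pb σ) (hPble : ∀ σ, Pb σ ≤ 1) {L σ : ℝ} (hL : 1 ≤ L) (hσ : L ^ 2 ≤ σ) :
    Pb σ * L ^ 3 ≤ 1 := by
  have hL0 : 0 < L := by linarith
  have hσ1 : 1 ≤ σ := le_trans (by nlinarith) hσ
  have h := probe_sq_mul_cube_eq hPb hode hP0 hσ1
  have h1 : Pb 1 ^ 2 ≤ 1 := by
    have := hPbnn 1; have := hPble 1; nlinarith
  have h2 : (Pb σ * L ^ 3) ^ 2 ≤ Pb σ ^ 2 * σ ^ 3 := by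
    have hL6 : (L ^ 3) ^ 2 ≤ σ ^ 3 := by
      calc (L ^ 3) ^ 2 = (L ^ 2) ^ 3 := by ring
        _ ≤ σ ^ 3 := pow_le_pow_left₀ (by positivity) hσ 3
    calc (Pb σ * L ^ 3) ^ 2 = Pb σ ^ 2 * (L ^ 3) ^ 2 := by ring
      _ ≤ Pb σ ^ 2 * σ ^ 3 := by gcongr
  exact (sq_le_one_iff₀ (mul_nonneg (hPbnn σ) (by positivity))).1 (by nlinarith)

/-- The cutoff profile `X = Θ_{1,2}` has a bounded derivative, which vanishes off `[1, 4]`.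
[folklore] -/
theorem exists_bound_deriv_cutoffProfile_one_two :
    ∃ C : ℝ, 0 ≤ C ∧ (∀ τ, |deriv (cutoffProfile 1 2) τ| ≤ C) ∧
      (∀ τ, τ < 1 → deriv (cutoffProfile 1 2) τ = 0) ∧
      (∀ τ, 4 < τ → deriv (cutoffProfile 1 2) τ = 0) := by
  set X : ℝ → ℝ := cutoffProfile 1 2 with hX
  have hXc : ContDiff ℝ ∞ X := cutoffProfile_contDiff _ _
  have hX1 : ∀ τ, τ ≤ 1 → X τ = 1 := fun τ hτ =>
    cutoffProfile_eq_one zero_le_one one_lt_two (by simpa using hτ)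
  have hX0 : ∀ τ, 4 ≤ τ → X τ = 0 := fun τ hτ =>
    cutoffProfile_eq_zero zero_le_one one_lt_two (by norm_num; linarith)
  have hdc : Continuous (deriv X) := hXc.continuous_deriv (by simp)
  have hlo : ∀ τ, τ < 1 → deriv X τ = 0 := fun τ hτ => by
    have heq : X =ᶠ[𝓝 τ] fun _ => 1 := by
      filter_upwards [Iio_mem_nhds hτ] with s hs using hX1 s hs.le
    rw [heq.deriv_eq, deriv_const]
  have hhi : ∀ τ, 4 < τ → deriv X τ = 0 := fun τ hτ => by
    have heq : X =ᶠ[𝓝 τ] fun _ => 0 := by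
      filter_upwards [Ioi_mem_nhds hτ] with s hs using hX0 s hs.le
    rw [heq.deriv_eq, deriv_const]
  obtain ⟨C, hC⟩ := (isCompact_Icc : IsCompact (Icc (1 : ℝ) 4)).exists_bound_of_continuousOn
    hdc.continuousOn
  have hC0 : 0 ≤ C := (norm_nonneg _).trans (hC 1 ⟨le_rfl, by norm_num⟩)
  refine ⟨C, hC0, fun τ => ?_, hlo, hhi⟩
  by_cases h1 : τ < 1
  · rw [hlo τ h1, abs_zero]; exact hC0
  by_cases h4 : 4 < τ
  · rw [hhi τ h4, abs_zero]; exact hC0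
  · rw [← Real.norm_eq_abs]
    exact hC τ ⟨not_lt.1 h1, not_lt.1 h4⟩

/-- **The radial test function.** For smooth `P̄` and `L > 0` there is a smooth `h : ℝ → ℝ`
with `h' = -(1/6) P̄ · X(·/L²)`, vanishing on `σ ≥ 4L²` (namely
`h(σ) = (1/6)∫_σ^{4L²} P̄(u) X(u/L²) du`). [folklore] -/
theorem exists_testProfile (hPb : ContDiff ℝ ∞ Pb) {L : ℝ} (hL : 0 < L) :
    ∃ h : ℝ → ℝ, ContDiff ℝ ∞ h ∧
      (∀ σ, HasDerivAt h (-(1 / 6) * (Pb σ * cutoffProfile 1 2 (σ / L ^ 2))) σ) ∧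
      (∀ σ, 4 * L ^ 2 ≤ σ → h σ = 0) := by
  set X : ℝ → ℝ := cutoffProfile 1 2 with hX
  have hXc : ContDiff ℝ ∞ X := cutoffProfile_contDiff _ _
  set f : ℝ → ℝ := fun u => Pb u * X (u / L ^ 2) with hf
  have hfc : ContDiff ℝ ∞ f := hPb.mul (hXc.comp (contDiff_id.div_const _))
  set h : ℝ → ℝ := fun σ => (1 / 6) * ∫ u in σ..(4 * L ^ 2), f u with hh
  have hderiv : ∀ σ, HasDerivAt h (-(1 / 6) * f σ) σ := fun σ => by
    have h1 : HasDerivAt (fun σ => ∫ u in σ..(4 * L ^ 2), f u) (-f σ) σ :=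
      intervalIntegral.integral_hasDerivAt_left (hfc.continuous.intervalIntegrable _ _)
        (hfc.continuous.stronglyMeasurableAtFilter _ _) hfc.continuous.continuousAt
    have h2 := h1.const_mul (1 / 6 : ℝ)
    refine h2.congr_deriv ?_
    ring
  have hdiff : Differentiable ℝ h := fun σ => (hderiv σ).differentiableAt
  have hd : deriv h = fun σ => -(1 / 6) * f σ := funext fun σ => (hderiv σ).deriv
  have hsmooth : ContDiff ℝ ∞ h :=
    contDiff_infty_iff_deriv.2 ⟨hdiff, by rw [hd]; exact contDiff_const.mul hfc⟩
  refine ⟨h, hsmooth, hderiv, fun σ hσ => ?_⟩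
  simp only [hh]
  rw [intervalIntegral.integral_symm, intervalIntegral.integral_zero_ae, neg_zero, mul_zero]
  refine Eventually.of_forall fun u hu => ?_
  rw [uIoc_of_le hσ] at hu
  have hu4 : 4 ≤ u / L ^ 2 := by
    rw [le_div_iff₀ (by positivity)]
    exact hu.1.le
  simp only [hf, hX, cutoffProfile_eq_zero zero_le_one one_lt_two (by norm_num; linarith), mul_zero]

/-- Second directional derivatives of a radial function `x ↦ g(|x|²)` along the diagonal:
`D²(g(|·|²))(z)(a, a) = 4 g''(|z|²) ⟨z, a⟩² + 2 g'(|z|²) |a|²`. [folklore] -/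
theorem fderiv_fderiv_comp_norm_sq_apply_self {g g₁ g₂ : ℝ → ℝ} (hg : ∀ σ, HasDerivAt g (g₁ σ) σ)
    (hg₁ : ∀ σ, HasDerivAt g₁ (g₂ σ) σ) (z a : EuclideanSpace ℝ (Fin 3)) :
    fderiv ℝ (fderiv ℝ (fun w : EuclideanSpace ℝ (Fin 3) => g (‖w‖ ^ 2))) z a a =
      4 * g₂ (‖z‖ ^ 2) * ⟪z, a⟫ ^ 2 + 2 * g₁ (‖z‖ ^ 2) * ‖a‖ ^ 2 := by
  have hD : DifferentiableAt ℝ (fderiv ℝ (fun w : EuclideanSpace ℝ (Fin 3) => g (‖w‖ ^ 2))) z :=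
    (hasFDerivAt_fderiv_comp_norm_sq isOpen_univ (fun σ _ => hg σ) (mem_univ _)
      (hg₁ _)).differentiableAt
  have h1 := fderiv_fderiv_comp_norm_sq_apply isOpen_univ (fun σ _ => hg σ) (mem_univ (‖z‖ ^ 2))
    (hg₁ (‖z‖ ^ 2)) a a
  have h2 : fderiv ℝ (fun w => fderiv ℝ (fun w : EuclideanSpace ℝ (Fin 3) => g (‖w‖ ^ 2)) w a) z a =
      fderiv ℝ (fderiv ℝ (fun w : EuclideanSpace ℝ (Fin 3) => g (‖w‖ ^ 2))) z a a := by
    rw [fderiv_clm_apply hD (differentiableAt_const a)]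
    simp
  rw [← h2, h1, real_inner_self_eq_norm_sq]
  ring

/-- Laplacian of a radial function `x ↦ g(|x|²)` on `ℝ³`: `Δ = 4σ g'' + 6 g'`. [folklore] -/
theorem laplacian_comp_norm_sq_fin3 {g g₁ g₂ : ℝ → ℝ} (hg : ∀ σ, HasDerivAt g (g₁ σ) σ)
    (hg₁ : ∀ σ, HasDerivAt g₁ (g₂ σ) σ) (z : EuclideanSpace ℝ (Fin 3)) :
    (Δ (fun w : EuclideanSpace ℝ (Fin 3) => g (‖w‖ ^ 2))) z =
      4 * g₂ (‖z‖ ^ 2) * ‖z‖ ^ 2 + 6 * g₁ (‖z‖ ^ 2) := by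
  rw [laplacian_comp_norm_sq isOpen_univ (fun σ _ => hg σ) (mem_univ (‖z‖ ^ 2)) (hg₁ _),
    finrank_euclideanSpace_fin]
  push_cast
  ring

/-- Volume of a closed ball of radius `2L` in `ℝ³`: `(2L)³ |B₁|`, finite. [folklore] -/
theorem volume_real_closedBall_two_mul (L : ℝ) (hL : 0 ≤ L) :
    (volume : Measure (EuclideanSpace ℝ (Fin 3))).real (closedBall 0 (2 * L)) =
      (2 * L) ^ 3 * (volume : Measure (EuclideanSpace ℝ (Fin 3))).real (ball 0 1) := by
  rw [Measure.addHaar_real_closedBall _ _ (by positivity), finrank_euclideanSpace_fin]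

/-- **The pressure–probe identity for `w ∈ C_c^∞(ℝ³; ℝ³)`** (centre `0`): for a probe pair
`(P, P̄)` (smooth, ODE `P̄ + (2/3)σP̄' = P`, `P = 0` on `σ ≥ 1`, `0 ≤ P̄ ≤ 1`),
`∫ p̃[w] P(|x|²) = -∫ ((2/3) P̄'(|x|²)⟨x, w⟩² + (1/3) P̄(|x|²)|w|²)`. This is the Hessian of the
Newtonian potential of the radial mass `P(|x|²)dx` tested against `w ⊗ w` (Newton's theorem
for radial masses), obtained here from the weak pressure Poisson equation. [folklore] -/
theorem integral_normalisedPressure_mul_probe_of_hasCompactSupport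
    (hP : ContDiff ℝ ∞ P) (hPb : ContDiff ℝ ∞ Pb)
    (hode : ∀ σ, Pb σ + 2 / 3 * σ * deriv Pb σ = P σ) (hP0 : ∀ σ, 1 ≤ σ → P σ = 0)
    (hPbnn : ∀ σ, 0 ≤ Pb σ) (hPble : ∀ σ, Pb σ ≤ 1)
    {w : EuclideanSpace ℝ (Fin 3) → EuclideanSpace ℝ (Fin 3)}
    (hw : ContDiff ℝ ∞ w) (hwc : HasCompactSupport w) :
    ∫ x, normalisedPressure w x * P (‖x‖ ^ 2) =
      -∫ x, (2 / 3 * deriv Pb (‖x‖ ^ 2) * ⟪x, w x⟫ ^ 2 + 1 / 3 * Pb (‖x‖ ^ 2) * ‖w x‖ ^ 2) := by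
  -- notation and basic facts
  set X : ℝ → ℝ := cutoffProfile 1 2 with hXdef
  have hXc : ContDiff ℝ ∞ X := cutoffProfile_contDiff _ _
  have hX1 : ∀ τ, τ ≤ 1 → X τ = 1 := fun τ hτ =>
    cutoffProfile_eq_one zero_le_one one_lt_two (by simpa using hτ)
  obtain ⟨CX, hCX0, hCX, hXlo, hXhi⟩ := exists_bound_deriv_cutoffProfile_one_two
  have hPbd : Differentiable ℝ Pb := hPb.differentiable (by simp)
  have hPbderiv : ∀ σ, HasDerivAt Pb (deriv Pb σ) σ := fun σ => (hPbd σ).hasDerivAt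
  have hPb'c : ContDiff ℝ ∞ (deriv Pb) := (contDiff_infty_iff_deriv.1 hPb).2
  have hXd : Differentiable ℝ X := hXc.differentiable (by simp)
  obtain ⟨Cp, hCp0, hCp⟩ := exists_abs_normalisedPressure_le_of_hasCompactSupport hw hwc
  have hpc : Continuous (normalisedPressure w) :=
    continuous_normalisedPressure_of_hasCompactSupport hw hwc
  obtain ⟨Rw, hRw0, hRw⟩ : ∃ R : ℝ, 0 < R ∧ ∀ y, w y ≠ 0 → ‖y‖ ≤ R := by
    obtain ⟨R, hR0, hR⟩ := hwc.isCompact.isBounded.exists_pos_norm_le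
    exact ⟨R, hR0, fun y hy => hR y (subset_tsupport _ (mem_support.2 hy))⟩
  set v₁ : ℝ := (volume : Measure (EuclideanSpace ℝ (Fin 3))).real (ball 0 1) with hv₁
  -- the target integrand
  set Hf : EuclideanSpace ℝ (Fin 3) → ℝ := fun x =>
    2 / 3 * deriv Pb (‖x‖ ^ 2) * ⟪x, w x⟫ ^ 2 + 1 / 3 * Pb (‖x‖ ^ 2) * ‖w x‖ ^ 2 with hHf
  set A : ℝ := ∫ x, normalisedPressure w x * P (‖x‖ ^ 2) with hA
  set B : ℝ := ∫ x, Hf x with hB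
  -- ### main estimate: `|A + B| ≤ K / L³` for every `L ≥ Rw + 1`
  set K : ℝ := Cp * (8 / 3 * CX) * (8 * v₁) with hK
  have hmain : ∀ L : ℝ, Rw + 1 ≤ L → |A + B| ≤ K / L ^ 3 := by
    intro L hL
    have hL1 : 1 ≤ L := by linarith
    have hL0 : 0 < L := by linarith
    have hL2 : 0 < L ^ 2 := by positivity
    -- the test function
    obtain ⟨h, hh, hh', hh0⟩ := exists_testProfile hPb hL0
    set h₁ : ℝ → ℝ := fun σ => -(1 / 6) * (Pb σ * X (σ / L ^ 2)) with hh₁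
    set h₂ : ℝ → ℝ := fun σ =>
      -(1 / 6) * (deriv Pb σ * X (σ / L ^ 2) + Pb σ * (deriv X (σ / L ^ 2) * (1 / L ^ 2))) with hh₂
    have hh₁d : ∀ σ, HasDerivAt h₁ (h₂ σ) σ := fun σ => by
      have hXL : HasDerivAt (fun σ => X (σ / L ^ 2)) (deriv X (σ / L ^ 2) * (1 / L ^ 2)) σ := by
        have := ((hXd (σ / L ^ 2)).hasDerivAt).comp σ ((hasDerivAt_id σ).div_const (L ^ 2))
        simpa [Function.comp_def, one_div] using this
      have := ((hPbderiv σ).mul hXL).const_mul (-(1 / 6) : ℝ)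
      simpa [hh₁, hh₂] using this
    set φ : EuclideanSpace ℝ (Fin 3) → ℝ := fun x => h (‖x‖ ^ 2) with hφ
    have hφc : ContDiff ℝ 2 φ := contDiff_infty.1 (hh.comp (contDiff_norm_sq ℝ)) 2
    have hφ0 : ∀ x : EuclideanSpace ℝ (Fin 3), 2 * L ≤ ‖x‖ → φ x = 0 := fun x hx => by
      simp only [hφ]
      refine hh0 _ ?_
      nlinarith [norm_nonneg x]
    have hφsupp : HasCompactSupport φ := by
      refine HasCompactSupport.intro (isCompact_closedBall (0 : EuclideanSpace ℝ (Fin 3)) (2 * L))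
        fun x hx => hφ0 x ?_
      rw [mem_closedBall, dist_zero_right, not_le] at hx
      exact hx.le
    -- Laplacian and Hessian of `φ`
    have hΔ : ∀ x : EuclideanSpace ℝ (Fin 3), Δ φ x =
        -P (‖x‖ ^ 2) - 2 / 3 * (‖x‖ ^ 2 / L ^ 2) * Pb (‖x‖ ^ 2) * deriv X (‖x‖ ^ 2 / L ^ 2) := by
      intro x
      have e := laplacian_comp_norm_sq_fin3 hh' hh₁d x
      simp only [hφ] at e ⊢
      rw [e]
      simp only [hh₂]
      have hode' := hode (‖x‖ ^ 2)
      -- `P · X(σ/L²) = P`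
      have hPX : P (‖x‖ ^ 2) * X (‖x‖ ^ 2 / L ^ 2) = P (‖x‖ ^ 2) := by
        by_cases hs : ‖x‖ ^ 2 ≤ 1
        · rw [hX1 _ ?_, mul_one]
          rw [div_le_one hL2]
          nlinarith
        · rw [hP0 _ (le_of_lt (not_le.1 hs)), zero_mul]
      have hP' : P (‖x‖ ^ 2) = (Pb (‖x‖ ^ 2) + 2 / 3 * ‖x‖ ^ 2 * deriv Pb (‖x‖ ^ 2)) *
          cutoffProfile 1 2 (‖x‖ ^ 2 / L ^ 2) := by
        rw [hode']; exact hPX.symm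
      rw [hP']
      field_simp
      ring
    have hHess : ∀ x : EuclideanSpace ℝ (Fin 3), fderiv ℝ (fderiv ℝ φ) x (w x) (w x) = -Hf x := by
      intro x
      by_cases hwx : w x = 0
      · simp [hHf, hwx]
      have hxR : ‖x‖ ≤ Rw := hRw x hwx
      have hσL : ‖x‖ ^ 2 / L ^ 2 < 1 := by
        rw [div_lt_one hL2]
        nlinarith [norm_nonneg x]
      have e := fderiv_fderiv_comp_norm_sq_apply_self hh' hh₁d x (w x)
      have hX1c : cutoffProfile 1 2 (‖x‖ ^ 2 / L ^ 2) = 1 := hX1 _ hσL.le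
      have hX1X : X (‖x‖ ^ 2 / L ^ 2) = 1 := hX1 _ hσL.le
      have hXloX : deriv X (‖x‖ ^ 2 / L ^ 2) = 0 := hXlo _ hσL
      simp only [hφ] at e ⊢
      rw [e]
      simp only [hh₂, hHf, hX1c, hX1X, hXloX]
      ring
    -- the weak Poisson equation
    have hIBP := integral_normalisedPressure_mul_laplacian hw hwc hφc hφsupp
    -- the error term
    set E : EuclideanSpace ℝ (Fin 3) → ℝ := fun x =>
      2 / 3 * (‖x‖ ^ 2 / L ^ 2) * Pb (‖x‖ ^ 2) * deriv X (‖x‖ ^ 2 / L ^ 2) with hE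
    have hEc : Continuous E := by
      have hn : Continuous fun x : EuclideanSpace ℝ (Fin 3) => ‖x‖ ^ 2 := continuous_norm.pow 2
      exact ((continuous_const.mul (hn.div_const _)).mul (hPb.continuous.comp hn)).mul
        ((hXc.continuous_deriv (by simp)).comp (hn.div_const _))
    have hE0 : ∀ x : EuclideanSpace ℝ (Fin 3), E x ≠ 0 → L ≤ ‖x‖ ∧ ‖x‖ ≤ 2 * L := by
      intro x hx
      have hd : deriv X (‖x‖ ^ 2 / L ^ 2) ≠ 0 := by
        intro h0; exact hx (by simp [hE, h0])
      have h1 : 1 ≤ ‖x‖ ^ 2 / L ^ 2 := not_lt.1 fun h => hd (hXlo _ h)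
      have h4 : ‖x‖ ^ 2 / L ^ 2 ≤ 4 := not_lt.1 fun h => hd (hXhi _ h)
      rw [le_div_iff₀ hL2] at h1
      rw [div_le_iff₀ hL2] at h4
      constructor
      · nlinarith [norm_nonneg x]
      · nlinarith [norm_nonneg x]
    have hEbound : ∀ x : EuclideanSpace ℝ (Fin 3), |E x| ≤ 8 / 3 * CX / L ^ 3 := by
      intro x
      by_cases hx : E x = 0
      · rw [hx, abs_zero]; positivity
      obtain ⟨hxlo, hxhi⟩ := hE0 x hx
      have hσ : L ^ 2 ≤ ‖x‖ ^ 2 := by nlinarith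
      have hPbL : Pb (‖x‖ ^ 2) * L ^ 3 ≤ 1 := probe_le_inv_cube hPbd hode hP0 hPbnn hPble hL1 hσ
      have hrat : ‖x‖ ^ 2 / L ^ 2 ≤ 4 := by
        rw [div_le_iff₀ hL2]; nlinarith [norm_nonneg x]
      have hrat0 : 0 ≤ ‖x‖ ^ 2 / L ^ 2 := by positivity
      simp only [hE]
      rw [abs_mul, abs_mul, abs_mul, abs_of_nonneg hrat0, abs_of_nonneg (hPbnn _),
        abs_of_nonneg (by norm_num : (0 : ℝ) ≤ 2 / 3)]
      have hL3 : 0 < L ^ 3 := by positivity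
      have hPbL' : Pb (‖x‖ ^ 2) ≤ 1 / L ^ 3 := by
        rw [le_div_iff₀ hL3]; exact hPbL
      calc 2 / 3 * (‖x‖ ^ 2 / L ^ 2) * Pb (‖x‖ ^ 2) * |deriv X (‖x‖ ^ 2 / L ^ 2)|
          ≤ 2 / 3 * 4 * (1 / L ^ 3) * CX := by
            gcongr
            · exact hPbnn _
            · exact hCX _
        _ = 8 / 3 * CX / L ^ 3 := by ring
    -- pointwise bound for `p̃ E`
    have hpE : ∀ x : EuclideanSpace ℝ (Fin 3), ‖normalisedPressure w x * E x‖ ≤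
        (closedBall (0 : EuclideanSpace ℝ (Fin 3)) (2 * L)).indicator
          (fun _ => Cp / L ^ 3 * (8 / 3 * CX / L ^ 3)) x := by
      intro x
      by_cases hx : E x = 0
      · rw [hx, mul_zero, norm_zero]
        exact Set.indicator_nonneg (fun _ _ => by positivity) _
      obtain ⟨hxlo, hxhi⟩ := hE0 x hx
      rw [Set.indicator_of_mem (by rw [mem_closedBall, dist_zero_right]; exact hxhi),
        Real.norm_eq_abs, abs_mul]
      have hp : |normalisedPressure w x| ≤ Cp / L ^ 3 := by
        refine (hCp x).trans ?_
        rw [div_eq_mul_inv]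
        refine mul_le_mul_of_nonneg_left ?_ hCp0
        rw [Real.rpow_neg (by positivity), show (3 : ℝ) = ((3 : ℕ) : ℝ) by norm_num,
          Real.rpow_natCast]
        exact inv_anti₀ (by positivity) (by nlinarith [pow_le_pow_left₀ hL0.le (by linarith : L ≤ 1 + ‖x‖) 3])
      exact mul_le_mul hp (hEbound x) (abs_nonneg _) (by positivity)
    have hdom : Integrable ((closedBall (0 : EuclideanSpace ℝ (Fin 3)) (2 * L)).indicator
        fun _ => Cp / L ^ 3 * (8 / 3 * CX / L ^ 3)) :=
      (integrableOn_const (measure_closedBall_lt_top (x := (0 : EuclideanSpace ℝ (Fin 3)))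
        (r := 2 * L)).ne).integrable_indicator measurableSet_closedBall
    have hpEint : Integrable fun x => normalisedPressure w x * E x :=
      hdom.mono' (hpc.mul hEc).aestronglyMeasurable (Eventually.of_forall hpE)
    have hpEle : |∫ x, normalisedPressure w x * E x| ≤ K / L ^ 3 := by
      rw [← Real.norm_eq_abs]
      refine (norm_integral_le_of_norm_le hdom (Eventually.of_forall hpE)).trans ?_
      rw [integral_indicator measurableSet_closedBall, setIntegral_const, smul_eq_mul,
        show (volume : Measure (EuclideanSpace ℝ (Fin 3))).real (closedBall 0 (2 * L)) =
          (2 * L) ^ 3 * v₁ from volume_real_closedBall_two_mul L hL0.le]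
      have hL3 : (0 : ℝ) < L ^ 3 := by positivity
      rw [hK]
      field_simp
      ring_nf
      nlinarith [hCp0, hCX0, show 0 ≤ v₁ from measureReal_nonneg, hL3]
    -- integrability of the main terms
    have hPc : Continuous fun x : EuclideanSpace ℝ (Fin 3) => P (‖x‖ ^ 2) :=
      hP.continuous.comp (continuous_norm.pow 2)
    have hAint : Integrable fun x => normalisedPressure w x * P (‖x‖ ^ 2) := by
      refine (hpc.mul hPc).integrable_of_hasCompactSupport ?_
      refine HasCompactSupport.intro (isCompact_closedBall (0 : EuclideanSpace ℝ (Fin 3)) 1)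
        fun x hx => ?_
      rw [mem_closedBall, dist_zero_right, not_le] at hx
      show normalisedPressure w x * P (‖x‖ ^ 2) = 0
      rw [hP0 _ (by nlinarith), mul_zero]
    have hHfc : Continuous Hf := by
      have hn : Continuous fun x : EuclideanSpace ℝ (Fin 3) => ‖x‖ ^ 2 := continuous_norm.pow 2
      exact ((continuous_const.mul (hPb'c.continuous.comp hn)).mul
        ((continuous_id.inner hw.continuous).pow 2)).add
        ((continuous_const.mul (hPb.continuous.comp hn)).mul (hw.continuous.norm.pow 2))
    have hHfsupp : HasCompactSupport Hf := by
      refine HasCompactSupport.intro (isCompact_closedBall (0 : EuclideanSpace ℝ (Fin 3)) Rw)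
        fun x hx => ?_
      rw [mem_closedBall, dist_zero_right, not_le] at hx
      have : w x = 0 := by
        by_contra hne; exact absurd (hRw x hne) (not_le.2 hx)
      simp [hHf, this]
    have hBint : Integrable Hf := hHfc.integrable_of_hasCompactSupport hHfsupp
    -- rewrite both sides of the weak Poisson equation
    have hL' : -∫ x, normalisedPressure w x * Δ φ x = A + ∫ x, normalisedPressure w x * E x := by
      have : (fun x => normalisedPressure w x * Δ φ x) =
          fun x => -(normalisedPressure w x * P (‖x‖ ^ 2) + normalisedPressure w x * E x) := by
        funext x; rw [hΔ x]; simp only [hE]; ring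
      rw [this, integral_neg, integral_add hAint hpEint, neg_neg]
    have hR' : ∫ x, fderiv ℝ (fderiv ℝ φ) x (w x) (w x) = -B := by
      rw [hB, ← integral_neg]
      exact integral_congr_ae (Eventually.of_forall hHess)
    rw [hL', hR'] at hIBP
    have : A + B = -∫ x, normalisedPressure w x * E x := by linarith
    rw [this, abs_neg]
    exact hpEle
  -- ### conclusion: `A + B = 0`
  have hAB : A + B = 0 := by
    by_contra hne
    have hpos : 0 < |A + B| := abs_pos.2 hne
    have hK0 : 0 ≤ K := by
      rw [hK]; exact mul_nonneg (mul_nonneg hCp0 (by positivity)) (by positivity)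
    -- choose `L` with `K / L³ < |A + B|`
    obtain ⟨L, hL⟩ : ∃ L : ℝ, Rw + 1 ≤ L ∧ K / L ^ 3 < |A + B| := by
      refine ⟨max (Rw + 1) (K / |A + B| + 1), le_max_left _ _, ?_⟩
      set L := max (Rw + 1) (K / |A + B| + 1) with hLdef
      have hL1 : 1 ≤ L := le_trans (by linarith) (le_max_left _ _)
      have hLK : K / |A + B| < L := lt_of_lt_of_le (by linarith) (le_max_right _ _)
      have hL3 : L ≤ L ^ 3 := by
        have h2 : 1 ≤ L ^ 2 := by nlinarith
        calc L = L * 1 := (mul_one L).symm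
          _ ≤ L * L ^ 2 := by gcongr
          _ = L ^ 3 := by ring
      rw [div_lt_iff₀ (by positivity)]
      rw [div_lt_iff₀ hpos] at hLK
      nlinarith
    exact absurd (hmain L hL.1) (not_le.2 hL.2)
  rw [hB] at hAB
  linarith

end Identity


/-! ## Part C. The identity for smooth finite-energy fields, at every centre and scale

The cut-off fields `χ_{n+1} w` converge to `w` with `p̃[χ_{n+1} w] → p̃[w]` pointwise
(`tendsto_normalisedPressure_cutoff`), with a bound uniform on the support of the probe
(`abs_normalisedPressure_le`: for `n ≥ 1` the cut-off field coincides with `w` on `B(x, 1)`,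
`|x| ≤ 1`), so both sides of the identity pass to the limit by dominated convergence. The
affine covariance `p̃[w(x₀ + s·)](x) = p̃[w](x₀ + s x)` (`normalisedPressure_comp_affine`) then
moves the identity to every centre `x₀` and scale `s > 0`. -/

section FiniteEnergy

variable {P Pb : ℝ → ℝ}

/-- `|σ P̄'(σ)| ≤ (3/2)(P + P̄)(σ) ≤ 3` for a probe pair (from the ODE), in the form
`|P̄'(σ)| σ ≤ 3`. [folklore] -/
theorem abs_deriv_mul_le_three (hode : ∀ σ, Pb σ + 2 / 3 * σ * deriv Pb σ = P σ)
    (hPnn : ∀ σ, 0 ≤ P σ) (hPle : ∀ σ, P σ ≤ Pb σ) (hPble : ∀ σ, Pb σ ≤ 1) {σ : ℝ} (hσ : 0 ≤ σ) :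
    |deriv Pb σ| * σ ≤ 3 := by
  have h := hode σ
  have h1 : 2 / 3 * σ * deriv Pb σ = P σ - Pb σ := by linarith
  have h2 : |2 / 3 * σ * deriv Pb σ| ≤ 2 := by
    rw [h1, abs_le]
    constructor <;> nlinarith [hPnn σ, hPle σ, hPble σ]
  rw [abs_mul, abs_mul, abs_of_nonneg hσ, abs_of_nonneg (by norm_num : (0 : ℝ) ≤ 2 / 3)] at h2
  nlinarith [abs_nonneg (deriv Pb σ)]

/-- **The pressure–probe identity for `w ∈ C^∞(ℝ³; ℝ³)` of finite energy** (centre `0`, unit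
scale). [folklore] -/
theorem integral_normalisedPressure_mul_probe
    (hP : ContDiff ℝ ∞ P) (hPb : ContDiff ℝ ∞ Pb)
    (hode : ∀ σ, Pb σ + 2 / 3 * σ * deriv Pb σ = P σ) (hP0 : ∀ σ, 1 ≤ σ → P σ = 0)
    (hPnn : ∀ σ, 0 ≤ P σ) (hPle : ∀ σ, P σ ≤ Pb σ) (hPble : ∀ σ, Pb σ ≤ 1)
    {w : EuclideanSpace ℝ (Fin 3) → EuclideanSpace ℝ (Fin 3)}
    (hw : ContDiff ℝ ∞ w) (hL2 : Integrable fun y => ‖w y‖ ^ 2) :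
    ∫ x, normalisedPressure w x * P (‖x‖ ^ 2) =
      -∫ x, (2 / 3 * deriv Pb (‖x‖ ^ 2) * ⟪x, w x⟫ ^ 2 + 1 / 3 * Pb (‖x‖ ^ 2) * ‖w x‖ ^ 2) := by
  have hPbnn : ∀ σ, 0 ≤ Pb σ := fun σ => (hPnn σ).trans (hPle σ)
  -- the cut-off fields
  set wn : ℕ → EuclideanSpace ℝ (Fin 3) → EuclideanSpace ℝ (Fin 3) :=
    fun n y => cutoff ((n : ℝ) + 1) y • w y with hwn
  have hwnc : ∀ n, ContDiff ℝ ∞ (wn n) := fun n => contDiff_cutoff_smul hw _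
  have hwns : ∀ n, HasCompactSupport (wn n) := fun n =>
    hasCompactSupport_cutoff_smul (Nat.cast_add_one_pos n)
  have hidn : ∀ n, ∫ x, normalisedPressure (wn n) x * P (‖x‖ ^ 2) =
      -∫ x, (2 / 3 * deriv Pb (‖x‖ ^ 2) * ⟪x, wn n x⟫ ^ 2 + 1 / 3 * Pb (‖x‖ ^ 2) * ‖wn n x‖ ^ 2) :=
    fun n => integral_normalisedPressure_mul_probe_of_hasCompactSupport hP hPb hode hP0 hPbnn hPble
      (hwnc n) (hwns n)
  -- ### convergence of the left-hand sides
  have hPc : Continuous fun x : EuclideanSpace ℝ (Fin 3) => P (‖x‖ ^ 2) :=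
    hP.continuous.comp (continuous_norm.pow 2)
  have hPsupp : ∀ x : EuclideanSpace ℝ (Fin 3), 1 < ‖x‖ → P (‖x‖ ^ 2) = 0 := fun x hx =>
    hP0 _ (by nlinarith)
  -- local bounds for `w` on `B̄(0, 2)`
  obtain ⟨M₀, hM₀⟩ := (isCompact_closedBall (0 : EuclideanSpace ℝ (Fin 3)) 2).exists_bound_of_continuousOn
    hw.continuous.continuousOn
  obtain ⟨M₁, hM₁⟩ := (isCompact_closedBall (0 : EuclideanSpace ℝ (Fin 3)) 2).exists_bound_of_continuousOn
    (hw.continuous_fderiv (by simp)).continuousOn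
  have hM₁0 : 0 ≤ M₁ := (norm_nonneg _).trans (hM₁ 0 (mem_closedBall_self (by norm_num)))
  have hw1 : ContDiff ℝ 1 w := hw.of_le (by simp)
  have hlip : ∀ x ∈ closedBall (0 : EuclideanSpace ℝ (Fin 3)) 1, ∀ y ∈ closedBall x 1,
      ‖w y - w x‖ ≤ M₁ * ‖y - x‖ := by
    intro x hx y hy
    have hsub : closedBall x 1 ⊆ closedBall (0 : EuclideanSpace ℝ (Fin 3)) 2 := by
      intro z hz
      rw [mem_closedBall, dist_zero_right] at hx ⊢
      rw [mem_closedBall, dist_eq_norm] at hz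
      calc ‖z‖ = ‖(z - x) + x‖ := by rw [sub_add_cancel]
        _ ≤ ‖z - x‖ + ‖x‖ := norm_add_le _ _
        _ ≤ 1 + 1 := add_le_add hz hx
        _ = 2 := by norm_num
    exact (convex_closedBall x 1).norm_image_sub_le_of_norm_fderiv_le
      (fun z _ => (hw1.differentiable (by simp) z))
      (fun z hz => hM₁ z (hsub hz)) (mem_closedBall_self zero_le_one) hy
  set E₀ : ℝ := ∫ y, ‖w y‖ ^ 2 with hE₀
  set Mp : ℝ := M₀ ^ 2 / 3 + 8 * M₀ * M₁ + E₀ / (2 * Real.pi) with hMp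
  -- for `n ≥ 1`, `wn n = w` on `B̄(0, 2)`
  have hwn_eq : ∀ n : ℕ, 1 ≤ n → ∀ y ∈ closedBall (0 : EuclideanSpace ℝ (Fin 3)) 2, wn n y = w y := by
    intro n hn y hy
    rw [mem_closedBall, dist_zero_right] at hy
    have h2 : ‖y‖ ≤ (n : ℝ) + 1 := hy.trans (by
      have : (1 : ℝ) ≤ n := by exact_mod_cast hn
      linarith)
    simp only [hwn, cutoff_eq_one (Nat.cast_add_one_pos n) h2, one_smul]
  have hbound_p : ∀ n : ℕ, 1 ≤ n → ∀ x ∈ closedBall (0 : EuclideanSpace ℝ (Fin 3)) 1,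
      |normalisedPressure (wn n) x| ≤ Mp := by
    intro n hn x hx
    have hsub : closedBall x 1 ⊆ closedBall (0 : EuclideanSpace ℝ (Fin 3)) 2 := by
      intro z hz
      rw [mem_closedBall, dist_zero_right] at hx ⊢
      rw [mem_closedBall, dist_eq_norm] at hz
      calc ‖z‖ = ‖(z - x) + x‖ := by rw [sub_add_cancel]
        _ ≤ ‖z - x‖ + ‖x‖ := norm_add_le _ _
        _ ≤ 1 + 1 := add_le_add hz hx
        _ = 2 := by norm_num
    have hEn : (∫⁻ y, ‖wn n y‖ₑ ^ 2) < ⊤ := by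
      have hint := integrable_norm_cutoff_smul_sq hw.continuous hL2 ((n : ℝ) + 1)
      have := hint.hasFiniteIntegral
      rw [hasFiniteIntegral_iff_enorm] at this
      refine lt_of_le_of_lt (le_of_eq (lintegral_congr fun y => ?_)) this
      rw [Real.enorm_eq_ofReal (sq_nonneg _), ENNReal.ofReal_pow (norm_nonneg _), ofReal_norm]
    have hx1 : x ∈ closedBall x 1 := mem_closedBall_self zero_le_one
    have h := abs_normalisedPressure_le ((hwnc n).of_le (by simp)) hEn
      (M₀ := M₀) (M₁ := M₁) (fun y hy => by rw [hwn_eq n hn y (hsub hy)]; exact hM₀ y (hsub hy))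
      (fun y hy => by
        rw [hwn_eq n hn y (hsub hy), hwn_eq n hn x (hsub hx1)]
        exact hlip x hx y hy) hM₁0
    refine h.trans ?_
    simp only [hMp]
    gcongr
    · rw [hE₀]
      refine integral_mono (integrable_norm_cutoff_smul_sq hw.continuous hL2 _) hL2 fun y => ?_
      exact pow_le_pow_left₀ (norm_nonneg _) (norm_cutoff_smul_le _ y) 2
  have hLHS : Tendsto (fun n => ∫ x, normalisedPressure (wn n) x * P (‖x‖ ^ 2)) atTop
      (𝓝 (∫ x, normalisedPressure w x * P (‖x‖ ^ 2))) := by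
    refine tendsto_integral_filter_of_dominated_convergence
      (fun x => (closedBall (0 : EuclideanSpace ℝ (Fin 3)) 1).indicator (fun _ => Mp) x) ?_ ?_ ?_ ?_
    · exact Eventually.of_forall fun n =>
        ((continuous_normalisedPressure_of_hasCompactSupport (hwnc n) (hwns n)).mul
          hPc).aestronglyMeasurable
    · filter_upwards [eventually_ge_atTop 1] with n hn
      refine Eventually.of_forall fun x => ?_
      by_cases hx : x ∈ closedBall (0 : EuclideanSpace ℝ (Fin 3)) 1
      · rw [indicator_of_mem hx, Real.norm_eq_abs, abs_mul]
        calc |normalisedPressure (wn n) x| * |P (‖x‖ ^ 2)| ≤ Mp * 1 := by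
              refine mul_le_mul (hbound_p n hn x hx) ?_ (abs_nonneg _) ?_
              · rw [abs_of_nonneg (hPnn _)]; exact (hPle _).trans (hPble _)
              · exact (abs_nonneg _).trans (hbound_p n hn x hx)
          _ = Mp := mul_one _
      · rw [mem_closedBall, dist_zero_right, not_le] at hx
        rw [hPsupp x hx, mul_zero, norm_zero]
        exact indicator_nonneg (fun y hy => (abs_nonneg _).trans (hbound_p n hn y hy)) _
    · exact (integrableOn_const (measure_closedBall_lt_top (x := (0 : EuclideanSpace ℝ (Fin 3)))
        (r := 1)).ne).integrable_indicator measurableSet_closedBall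
    · exact Eventually.of_forall fun x =>
        (tendsto_normalisedPressure_cutoff hw hL2 x).mul_const _
  -- ### convergence of the right-hand sides
  set Hf : (EuclideanSpace ℝ (Fin 3) → EuclideanSpace ℝ (Fin 3)) → EuclideanSpace ℝ (Fin 3) → ℝ :=
    fun v x => 2 / 3 * deriv Pb (‖x‖ ^ 2) * ⟪x, v x⟫ ^ 2 + 1 / 3 * Pb (‖x‖ ^ 2) * ‖v x‖ ^ 2 with hHf
  have hPbd : Differentiable ℝ Pb := hPb.differentiable (by simp)
  have hPb'c : Continuous (deriv Pb) := hPb.continuous_deriv (by simp)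
  have hHfc : ∀ {v : EuclideanSpace ℝ (Fin 3) → EuclideanSpace ℝ (Fin 3)}, Continuous v →
      Continuous (Hf v) := by
    intro v hv
    have hn : Continuous fun x : EuclideanSpace ℝ (Fin 3) => ‖x‖ ^ 2 := continuous_norm.pow 2
    exact ((continuous_const.mul (hPb'c.comp hn)).mul ((continuous_id.inner hv).pow 2)).add
      ((continuous_const.mul (hPb.continuous.comp hn)).mul (hv.norm.pow 2))
  have hHf_bound : ∀ (v : EuclideanSpace ℝ (Fin 3) → EuclideanSpace ℝ (Fin 3)) x,
      |Hf v x| ≤ 3 * ‖v x‖ ^ 2 := by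
    intro v x
    have h1 : |2 / 3 * deriv Pb (‖x‖ ^ 2) * ⟪x, v x⟫ ^ 2| ≤ 2 * ‖v x‖ ^ 2 := by
      rw [abs_mul, abs_mul, abs_of_nonneg (by norm_num : (0 : ℝ) ≤ 2 / 3),
        abs_of_nonneg (sq_nonneg ⟪x, v x⟫)]
      have hcs : ⟪x, v x⟫ ^ 2 ≤ ‖x‖ ^ 2 * ‖v x‖ ^ 2 := by
        have h0 := abs_real_inner_le_norm x (v x)
        calc ⟪x, v x⟫ ^ 2 = |⟪x, v x⟫| ^ 2 := (sq_abs _).symm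
          _ ≤ (‖x‖ * ‖v x‖) ^ 2 := pow_le_pow_left₀ (abs_nonneg _) h0 2
          _ = ‖x‖ ^ 2 * ‖v x‖ ^ 2 := by ring
      have h3 := abs_deriv_mul_le_three hode hPnn hPle hPble (sq_nonneg ‖x‖)
      calc 2 / 3 * |deriv Pb (‖x‖ ^ 2)| * ⟪x, v x⟫ ^ 2
          ≤ 2 / 3 * |deriv Pb (‖x‖ ^ 2)| * (‖x‖ ^ 2 * ‖v x‖ ^ 2) := by gcongr
        _ = 2 / 3 * (|deriv Pb (‖x‖ ^ 2)| * ‖x‖ ^ 2) * ‖v x‖ ^ 2 := by ring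
        _ ≤ 2 / 3 * 3 * ‖v x‖ ^ 2 := by gcongr
        _ = 2 * ‖v x‖ ^ 2 := by ring
    have h2 : |1 / 3 * Pb (‖x‖ ^ 2) * ‖v x‖ ^ 2| ≤ 1 * ‖v x‖ ^ 2 := by
      rw [abs_mul, abs_mul, abs_of_nonneg (by norm_num : (0 : ℝ) ≤ 1 / 3),
        abs_of_nonneg (hPbnn _), abs_of_nonneg (sq_nonneg _)]
      calc 1 / 3 * Pb (‖x‖ ^ 2) * ‖v x‖ ^ 2 ≤ 1 / 3 * 1 * ‖v x‖ ^ 2 := by gcongr; exact hPble _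
        _ ≤ 1 * ‖v x‖ ^ 2 := by nlinarith [sq_nonneg ‖v x‖]
    calc |Hf v x| ≤ |2 / 3 * deriv Pb (‖x‖ ^ 2) * ⟪x, v x⟫ ^ 2| + |1 / 3 * Pb (‖x‖ ^ 2) * ‖v x‖ ^ 2| :=
          abs_add_le _ _
      _ ≤ 2 * ‖v x‖ ^ 2 + 1 * ‖v x‖ ^ 2 := add_le_add h1 h2
      _ = 3 * ‖v x‖ ^ 2 := by ring
  have hHfn : ∀ n x, Hf (wn n) x = cutoff ((n : ℝ) + 1) x ^ 2 * Hf w x := by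
    intro n x
    simp only [hHf, hwn, inner_smul_right, norm_smul, Real.norm_eq_abs]
    rw [mul_pow, mul_pow, sq_abs]
    ring
  have hRHS : Tendsto (fun n => ∫ x, Hf (wn n) x) atTop (𝓝 (∫ x, Hf w x)) := by
    refine tendsto_integral_of_dominated_convergence (fun x => 3 * ‖w x‖ ^ 2) ?_ ?_ ?_ ?_
    · exact fun n => (hHfc (hwnc n).continuous).aestronglyMeasurable
    · exact hL2.const_mul 3
    · intro n
      refine Eventually.of_forall fun x => ?_
      rw [Real.norm_eq_abs]
      refine (hHf_bound (wn n) x).trans ?_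
      gcongr
      exact norm_cutoff_smul_le _ x
    · refine Eventually.of_forall fun x => ?_
      have h1 : Tendsto (fun n : ℕ => cutoff ((n : ℝ) + 1) x ^ 2) atTop (𝓝 1) := by
        simpa using (tendsto_cutoff_natCast_add_one x).pow 2
      simp_rw [hHfn]
      simpa using h1.mul_const (Hf w x)
  -- ### conclusion
  have heq : (fun n => ∫ x, normalisedPressure (wn n) x * P (‖x‖ ^ 2)) =
      fun n => -∫ x, Hf (wn n) x := funext fun n => hidn n
  rw [heq] at hLHS
  exact tendsto_nhds_unique hLHS hRHS.neg

/-- Change of variables `x = x₀ + s y` in `ℝ³`: `∫ g = s³ ∫ g(x₀ + s y) dy` (`s > 0`). [folklore] -/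
theorem integral_comp_affine_fin3 (g : EuclideanSpace ℝ (Fin 3) → ℝ) (x₀ : EuclideanSpace ℝ (Fin 3))
    {s : ℝ} (hs : 0 < s) : ∫ x, g x = s ^ 3 * ∫ y, g (x₀ + s • y) := by
  have h1 : ∫ y, g (x₀ + s • y) = |(s ^ 3)⁻¹| * ∫ z, g (x₀ + z) := by
    have := Measure.integral_comp_smul (volume : Measure (EuclideanSpace ℝ (Fin 3)))
      (fun z => g (x₀ + z)) s
    rw [finrank_euclideanSpace_fin] at this
    simpa [smul_eq_mul] using this
  rw [h1, integral_add_left_eq_self, abs_of_pos (by positivity), ← mul_assoc,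
    mul_inv_cancel₀ (by positivity), one_mul]

/-- **The pressure–probe identity at centre `x₀` and scale `s > 0`**: for `w ∈ C^∞` of finite
energy and a probe pair `(P, P̄)`,
`∫ p̃[w](x) P(|x-x₀|²/s²) dx = -∫ ((2/3) s⁻² P̄'(|x-x₀|²/s²) ⟨x-x₀, w⟩² + (1/3) P̄(|x-x₀|²/s²) |w|²)`
(affine covariance of `p̃` and the change of variables `x = x₀ + s y`). [folklore] -/
theorem integral_normalisedPressure_mul_probe_scaled
    (hP : ContDiff ℝ ∞ P) (hPb : ContDiff ℝ ∞ Pb)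
    (hode : ∀ σ, Pb σ + 2 / 3 * σ * deriv Pb σ = P σ) (hP0 : ∀ σ, 1 ≤ σ → P σ = 0)
    (hPnn : ∀ σ, 0 ≤ P σ) (hPle : ∀ σ, P σ ≤ Pb σ) (hPble : ∀ σ, Pb σ ≤ 1)
    {w : EuclideanSpace ℝ (Fin 3) → EuclideanSpace ℝ (Fin 3)}
    (hw : ContDiff ℝ ∞ w) (hL2 : Integrable fun y => ‖w y‖ ^ 2)
    (x₀ : EuclideanSpace ℝ (Fin 3)) {s : ℝ} (hs : 0 < s) :
    ∫ x, normalisedPressure w x * P (‖x - x₀‖ ^ 2 / s ^ 2) =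
      -∫ x, (2 / 3 * (deriv Pb (‖x - x₀‖ ^ 2 / s ^ 2) / s ^ 2) * ⟪x - x₀, w x⟫ ^ 2 +
        1 / 3 * Pb (‖x - x₀‖ ^ 2 / s ^ 2) * ‖w x‖ ^ 2) := by
  -- the rescaled field
  set v : EuclideanSpace ℝ (Fin 3) → EuclideanSpace ℝ (Fin 3) := fun y => w (x₀ + s • y) with hv
  have hvc : ContDiff ℝ ∞ v :=
    hw.comp (contDiff_const.add (contDiff_id.const_smul s))
  have hvL2 : Integrable fun y => ‖v y‖ ^ 2 := by
    have h1 : Integrable (fun z => ‖w (x₀ + z)‖ ^ 2) := hL2.comp_add_left x₀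
    exact (integrable_comp_smul_iff (volume : Measure (EuclideanSpace ℝ (Fin 3)))
      (fun z => ‖w (x₀ + z)‖ ^ 2) hs.ne').2 h1
  have hid := integral_normalisedPressure_mul_probe hP hPb hode hP0 hPnn hPle hPble hvc hvL2
  have hpv : ∀ y, normalisedPressure v y = normalisedPressure w (x₀ + s • y) := fun y =>
    normalisedPressure_comp_affine w x₀ hs y
  -- change variables on both sides
  have hnorm : ∀ y : EuclideanSpace ℝ (Fin 3), ‖x₀ + s • y - x₀‖ ^ 2 / s ^ 2 = ‖y‖ ^ 2 := by
    intro y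
    rw [add_sub_cancel_left, norm_smul, Real.norm_eq_abs, abs_of_pos hs]
    field_simp
  rw [integral_comp_affine_fin3 _ x₀ hs, integral_comp_affine_fin3 (fun x =>
    2 / 3 * (deriv Pb (‖x - x₀‖ ^ 2 / s ^ 2) / s ^ 2) * ⟪x - x₀, w x⟫ ^ 2 +
      1 / 3 * Pb (‖x - x₀‖ ^ 2 / s ^ 2) * ‖w x‖ ^ 2) x₀ hs]
  simp_rw [hnorm, ← hpv]
  rw [hid, ← mul_neg]
  congr 1
  rw [← integral_neg, ← integral_neg]
  refine integral_congr_ae (Eventually.of_forall fun y => ?_)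
  simp only [hv, add_sub_cancel_left, inner_smul_left, RCLike.conj_to_real]
  field_simp

end FiniteEnergy


/-! ## Part D. Monotonicity of the scaled kinetic energy and the Type I bound

Fix a probe pair, a centre `x₀` and `w ∈ C^∞` of finite energy, and put
`F(s) = ∫ |w|² s⁻¹ P̄(|x - x₀|²/s²)` (a smoothed version of `s⁻¹ ∫_{B(x₀,s)} |w|²`).
Then `F(S) - F(r) = ∫_r^S s⁻² G(s) ds` with `G(s) = ∫ |w|² (2P̄ - 3P)(|x-x₀|²/s²)`, and the
identity of Part C gives `G(s) = 3∫ p̃[w] P_s + 2∫ (-P̄')(τ) s⁻²(|x-x₀|²|w|² - ⟨x-x₀, w⟩²) ≥ 3∫ p̃ P_s`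
(and, in the head-pressure case, `G(s) ≥ -3M∫P_s` directly). Under `p̃ ≥ -M` (or
`|w|² + 2p̃ ≤ M`) on `B(x₀, S)` this makes `F(s) + (3/2) M c_P s²` non-decreasing on `(0, S]`,
whence the Type I bound `r⁻¹ ∫_{B(x₀, r/2)} |w|² ≤ ‖w‖₂²/S + (3/2) M c_P S²` for `r ≤ S`. -/

section Monotonicity

variable {P Pb : ℝ → ℝ}

/-- Continuity of the normalised pressure of a smooth finite-energy field (it is the `C²`
pressure potential of `PressureRepresentation`). [folklore] -/
theorem continuous_normalisedPressure_of_integrable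
    {w : EuclideanSpace ℝ (Fin 3) → EuclideanSpace ℝ (Fin 3)}
    (hw : ContDiff ℝ ∞ w) (hL2 : Integrable fun y => ‖w y‖ ^ 2) :
    Continuous (normalisedPressure w) := by
  have h : normalisedPressure w = pressurePotential w :=
    funext fun x => normalisedPressure_eq_pressurePotential (hw.of_le (by norm_cast)) hL2 x
  rw [h]
  exact (contDiff_pressurePotential (hw.of_le (by norm_cast)) hL2).continuous

/-- **The scale derivative of the kernel** `k(s) = s⁻¹ P̄(σ/s²)`: for `σ` fixed and `s > 0`,
`k'(s) = s⁻²(2P̄ - 3P)(σ/s²)` (ODE `2τP̄' = 3(P - P̄)`); integrated form on `[r, S]`. [folklore] -/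
theorem kernel_sub_eq_integral (hPb : ContDiff ℝ ∞ Pb) (hP : ContDiff ℝ ∞ P)
    (hode : ∀ σ, Pb σ + 2 / 3 * σ * deriv Pb σ = P σ) (σ : ℝ) {r S : ℝ} (hr : 0 < r) (hrS : r ≤ S) :
    S⁻¹ * Pb (σ / S ^ 2) - r⁻¹ * Pb (σ / r ^ 2) =
      ∫ s in r..S, (s ^ 2)⁻¹ * (2 * Pb (σ / s ^ 2) - 3 * P (σ / s ^ 2)) := by
  have hPbd : Differentiable ℝ Pb := hPb.differentiable (by simp)
  set k : ℝ → ℝ := fun s => s⁻¹ * Pb (σ / s ^ 2) with hk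
  set k' : ℝ → ℝ := fun s => (s ^ 2)⁻¹ * (2 * Pb (σ / s ^ 2) - 3 * P (σ / s ^ 2)) with hk'
  have hderiv : ∀ s, 0 < s → HasDerivAt k (k' s) s := by
    intro s hs
    have hs0 : s ≠ 0 := hs.ne'
    have h1 : HasDerivAt (fun s : ℝ => σ / s ^ 2) (σ * (-(↑(2 : ℕ) * s ^ (2 - 1)) / (s ^ 2) ^ 2)) s := by
      have := ((hasDerivAt_pow 2 s).inv (pow_ne_zero 2 hs0)).const_mul σ
      simpa [div_eq_mul_inv] using this
    have h2 : HasDerivAt (fun s : ℝ => Pb (σ / s ^ 2))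
        (deriv Pb (σ / s ^ 2) * (σ * (-(↑(2 : ℕ) * s ^ (2 - 1)) / (s ^ 2) ^ 2))) s :=
      (hPbd _).hasDerivAt.comp s h1
    have h3 : HasDerivAt (fun s : ℝ => s⁻¹) (-(s ^ 2)⁻¹) s := hasDerivAt_inv hs0
    have h4 := h3.mul h2
    refine h4.congr_deriv ?_
    simp only [hk']
    have hodeτ := hode (σ / s ^ 2)
    have hP' : 3 * P (σ / s ^ 2) = 3 * Pb (σ / s ^ 2) + 2 * (σ / s ^ 2) * deriv Pb (σ / s ^ 2) := by
      linarith
    rw [hP']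
    push_cast
    field_simp
    ring
  have hcont : ContinuousOn k' (uIcc r S) := by
    intro s hs
    rw [uIcc_of_le hrS] at hs
    have hs0 : s ≠ 0 := (lt_of_lt_of_le hr hs.1).ne'
    have hτ : ContinuousAt (fun s : ℝ => σ / s ^ 2) s :=
      continuousAt_const.div (continuousAt_id.pow 2) (pow_ne_zero 2 hs0)
    refine ContinuousAt.continuousWithinAt ?_
    exact ((continuousAt_id.pow 2).inv₀ (pow_ne_zero 2 hs0)).mul
      ((continuousAt_const.mul (hPb.continuous.continuousAt.comp hτ)).sub
        (continuousAt_const.mul (hP.continuous.continuousAt.comp hτ)))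
  have hint : IntervalIntegrable k' volume r S := hcont.intervalIntegrable
  have hFTC := intervalIntegral.integral_eq_sub_of_hasDerivAt (f := k) (f' := k')
    (fun s hs => hderiv s (by rw [uIcc_of_le hrS] at hs; exact lt_of_lt_of_le hr hs.1)) hint
  simp only [hk] at hFTC
  rw [hFTC]

/-- **The monotonicity formula.** For a probe pair, `w ∈ C^∞` of finite energy, a centre `x₀`
and `0 < r ≤ S`:
`F(S) - F(r) = ∫_r^S s⁻² G(s) ds`, `F(s) = ∫ |w|² s⁻¹P̄(|x-x₀|²/s²)`,
`G(s) = ∫ |w|²(2P̄ - 3P)(|x-x₀|²/s²)` (Fubini). [folklore] -/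
theorem scaledEnergy_sub_eq_integral (hP : ContDiff ℝ ∞ P) (hPb : ContDiff ℝ ∞ Pb)
    (hode : ∀ σ, Pb σ + 2 / 3 * σ * deriv Pb σ = P σ)
    (hPnn : ∀ σ, 0 ≤ P σ) (hPle : ∀ σ, P σ ≤ Pb σ) (hPble : ∀ σ, Pb σ ≤ 1)
    {w : EuclideanSpace ℝ (Fin 3) → EuclideanSpace ℝ (Fin 3)}
    (hw : ContDiff ℝ ∞ w) (hL2 : Integrable fun y => ‖w y‖ ^ 2)
    (x₀ : EuclideanSpace ℝ (Fin 3)) {r S : ℝ} (hr : 0 < r) (hrS : r ≤ S) :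
    (∫ x, ‖w x‖ ^ 2 * (S⁻¹ * Pb (‖x - x₀‖ ^ 2 / S ^ 2))) -
        ∫ x, ‖w x‖ ^ 2 * (r⁻¹ * Pb (‖x - x₀‖ ^ 2 / r ^ 2)) =
      ∫ s in r..S, (s ^ 2)⁻¹ *
        ∫ x, ‖w x‖ ^ 2 * (2 * Pb (‖x - x₀‖ ^ 2 / s ^ 2) - 3 * P (‖x - x₀‖ ^ 2 / s ^ 2)) := by
  have hPbnn : ∀ σ, 0 ≤ Pb σ := fun σ => (hPnn σ).trans (hPle σ)
  have hwc : Continuous w := hw.continuous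
  have hn : Continuous fun x : EuclideanSpace ℝ (Fin 3) => ‖x - x₀‖ ^ 2 :=
    (continuous_id.sub continuous_const).norm.pow 2
  -- integrability of the kernels `|w|² s⁻¹ P̄(σ/s²)`
  have hk_int : ∀ s : ℝ, Integrable fun x => ‖w x‖ ^ 2 * (s⁻¹ * Pb (‖x - x₀‖ ^ 2 / s ^ 2)) := by
    intro s
    refine (hL2.mul_const |s⁻¹|).mono' ?_ (Eventually.of_forall fun x => ?_)
    · exact ((hwc.norm.pow 2).mul (continuous_const.mul
        (hPb.continuous.comp (hn.div_const _)))).aestronglyMeasurable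
    · rw [Real.norm_eq_abs, abs_mul, abs_of_nonneg (sq_nonneg _), abs_mul, abs_of_nonneg (hPbnn _)]
      calc ‖w x‖ ^ 2 * (|s⁻¹| * Pb (‖x - x₀‖ ^ 2 / s ^ 2)) ≤ ‖w x‖ ^ 2 * (|s⁻¹| * 1) := by
            gcongr; exact hPble _
        _ = ‖w x‖ ^ 2 * |s⁻¹| := by ring
  -- the integrand of the double integral
  set f : EuclideanSpace ℝ (Fin 3) → ℝ → ℝ := fun x s =>
    ‖w x‖ ^ 2 * ((s ^ 2)⁻¹ * (2 * Pb (‖x - x₀‖ ^ 2 / s ^ 2) - 3 * P (‖x - x₀‖ ^ 2 / s ^ 2))) with hf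
  have hwm : Measurable w := hwc.measurable
  have hPbm : Measurable Pb := hPb.continuous.measurable
  have hPm : Measurable P := hP.continuous.measurable
  have hfm : Measurable (uncurry f) := by
    simp only [hf]
    fun_prop
  -- product integrability on `ℝ³ × (r, S]`
  set ν : Measure ℝ := volume.restrict (Ioc r S) with hν
  haveI : IsFiniteMeasure ν := by rw [hν]; infer_instance
  have hbound : ∀ x, ∀ s ∈ Ioc r S, ‖uncurry f (x, s)‖ ≤ (5 * (r ^ 2)⁻¹) * ‖w x‖ ^ 2 * 1 := by
    intro x s hs
    have hs0 : 0 < s := lt_of_lt_of_le hr hs.1.le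
    simp only [uncurry, hf, Real.norm_eq_abs, mul_one]
    rw [abs_mul, abs_of_nonneg (sq_nonneg _), abs_mul, abs_of_nonneg (by positivity)]
    have h5 : |2 * Pb (‖x - x₀‖ ^ 2 / s ^ 2) - 3 * P (‖x - x₀‖ ^ 2 / s ^ 2)| ≤ 5 := by
      rw [abs_le]; constructor <;> nlinarith [hPbnn (‖x - x₀‖ ^ 2 / s ^ 2),
        hPble (‖x - x₀‖ ^ 2 / s ^ 2), hPnn (‖x - x₀‖ ^ 2 / s ^ 2), hPle (‖x - x₀‖ ^ 2 / s ^ 2)]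
    have hrs : (s ^ 2)⁻¹ ≤ (r ^ 2)⁻¹ := by
      apply inv_anti₀ (by positivity)
      exact pow_le_pow_left₀ hr.le hs.1.le 2
    calc ‖w x‖ ^ 2 * ((s ^ 2)⁻¹ * |2 * Pb (‖x - x₀‖ ^ 2 / s ^ 2) - 3 * P (‖x - x₀‖ ^ 2 / s ^ 2)|)
        ≤ ‖w x‖ ^ 2 * ((r ^ 2)⁻¹ * 5) := by gcongr
      _ = 5 * (r ^ 2)⁻¹ * ‖w x‖ ^ 2 := by ring
  have hprod : Integrable (uncurry f) ((volume : Measure (EuclideanSpace ℝ (Fin 3))).prod ν) := by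
    have hdom : Integrable (fun z : EuclideanSpace ℝ (Fin 3) × ℝ => (5 * (r ^ 2)⁻¹) * ‖w z.1‖ ^ 2 * 1)
        ((volume : Measure (EuclideanSpace ℝ (Fin 3))).prod ν) := by
      have := (hL2.const_mul (5 * (r ^ 2)⁻¹)).mul_prod (integrable_const (1 : ℝ) (μ := ν))
      simpa [mul_assoc] using this
    refine hdom.mono' hfm.aestronglyMeasurable ?_
    have hmem : ∀ᵐ z ∂((volume : Measure (EuclideanSpace ℝ (Fin 3))).prod ν), z.2 ∈ Ioc r S :=
      (Measure.quasiMeasurePreserving_snd (μ := (volume : Measure (EuclideanSpace ℝ (Fin 3)))) (ν := ν)).ae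
        (by rw [hν]; exact ae_restrict_mem measurableSet_Ioc)
    filter_upwards [hmem] with z hz
    exact hbound z.1 z.2 hz
  -- Step 1: pointwise FTC inside the `x`-integral
  have hstep1 : (∫ x, ‖w x‖ ^ 2 * (S⁻¹ * Pb (‖x - x₀‖ ^ 2 / S ^ 2))) -
      ∫ x, ‖w x‖ ^ 2 * (r⁻¹ * Pb (‖x - x₀‖ ^ 2 / r ^ 2)) = ∫ x, ∫ s in r..S, f x s := by
    rw [← integral_sub (hk_int S) (hk_int r)]
    refine integral_congr_ae (Eventually.of_forall fun x => ?_)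
    simp only [hf]
    rw [← mul_sub, kernel_sub_eq_integral hPb hP hode (‖x - x₀‖ ^ 2) hr hrS,
      ← intervalIntegral.integral_const_mul]
  -- Step 2: Fubini
  have hstep2 : ∫ x, ∫ s in r..S, f x s = ∫ s in r..S, ∫ x, f x s := by
    simp_rw [intervalIntegral.integral_of_le hrS]
    exact integral_integral_swap hprod
  rw [hstep1, hstep2]
  refine intervalIntegral.integral_congr fun s _ => ?_
  simp only [hf]
  rw [← integral_const_mul]
  refine integral_congr_ae (Eventually.of_forall fun x => ?_)
  ring

/-- **`G(s) ≥ 3 ∫ p̃[w] P_s`** (pressure-floor form): by the identity of Part C at scale `s`,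
`G(s) - 3∫ p̃ P_s = 2∫ (-P̄'(τ)) s⁻² (|x-x₀|²|w|² - ⟨x-x₀,w⟩²) ≥ 0` (`P̄' ≤ 0`, Cauchy–Schwarz).
[folklore] -/
theorem three_mul_integral_pressure_probe_le (hP : ContDiff ℝ ∞ P) (hPb : ContDiff ℝ ∞ Pb)
    (hode : ∀ σ, Pb σ + 2 / 3 * σ * deriv Pb σ = P σ) (hP0 : ∀ σ, 1 ≤ σ → P σ = 0)
    (hPnn : ∀ σ, 0 ≤ P σ) (hPle : ∀ σ, P σ ≤ Pb σ) (hPble : ∀ σ, Pb σ ≤ 1)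
    (hPb' : ∀ σ, deriv Pb σ ≤ 0)
    {w : EuclideanSpace ℝ (Fin 3) → EuclideanSpace ℝ (Fin 3)}
    (hw : ContDiff ℝ ∞ w) (hL2 : Integrable fun y => ‖w y‖ ^ 2)
    (x₀ : EuclideanSpace ℝ (Fin 3)) {s : ℝ} (hs : 0 < s) :
    3 * ∫ x, normalisedPressure w x * P (‖x - x₀‖ ^ 2 / s ^ 2) ≤
      ∫ x, ‖w x‖ ^ 2 * (2 * Pb (‖x - x₀‖ ^ 2 / s ^ 2) - 3 * P (‖x - x₀‖ ^ 2 / s ^ 2)) := by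
  have hPbnn : ∀ σ, 0 ≤ Pb σ := fun σ => (hPnn σ).trans (hPle σ)
  have hid := integral_normalisedPressure_mul_probe_scaled hP hPb hode hP0 hPnn hPle hPble hw hL2 x₀ hs
  have hwc : Continuous w := hw.continuous
  have hn : Continuous fun x : EuclideanSpace ℝ (Fin 3) => ‖x - x₀‖ ^ 2 / s ^ 2 :=
    ((continuous_id.sub continuous_const).norm.pow 2).div_const _
  have hPb'c : Continuous (deriv Pb) := hPb.continuous_deriv (by simp)
  -- the two integrands and their integrability (both are `O(|w|²)`)
  set A₁ : EuclideanSpace ℝ (Fin 3) → ℝ := fun x =>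
    2 / 3 * (deriv Pb (‖x - x₀‖ ^ 2 / s ^ 2) / s ^ 2) * ⟪x - x₀, w x⟫ ^ 2 +
      1 / 3 * Pb (‖x - x₀‖ ^ 2 / s ^ 2) * ‖w x‖ ^ 2 with hA₁
  set A₂ : EuclideanSpace ℝ (Fin 3) → ℝ := fun x =>
    ‖w x‖ ^ 2 * (2 * Pb (‖x - x₀‖ ^ 2 / s ^ 2) - 3 * P (‖x - x₀‖ ^ 2 / s ^ 2)) with hA₂
  have hτnn : ∀ x : EuclideanSpace ℝ (Fin 3), 0 ≤ ‖x - x₀‖ ^ 2 / s ^ 2 := fun x => by positivity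
  have hkey : ∀ x : EuclideanSpace ℝ (Fin 3),
      |deriv Pb (‖x - x₀‖ ^ 2 / s ^ 2) / s ^ 2 * ⟪x - x₀, w x⟫ ^ 2| ≤ 3 * ‖w x‖ ^ 2 := by
    intro x
    have hcs : ⟪x - x₀, w x⟫ ^ 2 ≤ ‖x - x₀‖ ^ 2 * ‖w x‖ ^ 2 := by
      have h0 := abs_real_inner_le_norm (x - x₀) (w x)
      calc ⟪x - x₀, w x⟫ ^ 2 = |⟪x - x₀, w x⟫| ^ 2 := (sq_abs _).symm
        _ ≤ (‖x - x₀‖ * ‖w x‖) ^ 2 := pow_le_pow_left₀ (abs_nonneg _) h0 2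
        _ = ‖x - x₀‖ ^ 2 * ‖w x‖ ^ 2 := by ring
    have h3 := abs_deriv_mul_le_three hode hPnn hPle hPble (hτnn x)
    rw [abs_mul, abs_div, abs_of_nonneg (sq_nonneg ⟪x - x₀, w x⟫), abs_of_nonneg (sq_nonneg s)]
    calc |deriv Pb (‖x - x₀‖ ^ 2 / s ^ 2)| / s ^ 2 * ⟪x - x₀, w x⟫ ^ 2
        ≤ |deriv Pb (‖x - x₀‖ ^ 2 / s ^ 2)| / s ^ 2 * (‖x - x₀‖ ^ 2 * ‖w x‖ ^ 2) := by gcongr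
      _ = |deriv Pb (‖x - x₀‖ ^ 2 / s ^ 2)| * (‖x - x₀‖ ^ 2 / s ^ 2) * ‖w x‖ ^ 2 := by
          field_simp
      _ ≤ 3 * ‖w x‖ ^ 2 := by gcongr
  have hA₁int : Integrable A₁ := by
    refine (hL2.const_mul 3).mono' ?_ (Eventually.of_forall fun x => ?_)
    · exact ((continuous_const.mul ((hPb'c.comp hn).div_const _)).mul
        (((continuous_id.sub continuous_const).inner hwc).pow 2)).add
        ((continuous_const.mul (hPb.continuous.comp hn)).mul (hwc.norm.pow 2)) |>.aestronglyMeasurable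
    · rw [Real.norm_eq_abs]
      simp only [hA₁]
      have h2 : |1 / 3 * Pb (‖x - x₀‖ ^ 2 / s ^ 2) * ‖w x‖ ^ 2| ≤ 1 * ‖w x‖ ^ 2 := by
        rw [abs_mul, abs_mul, abs_of_nonneg (by norm_num : (0 : ℝ) ≤ 1 / 3),
          abs_of_nonneg (hPbnn _), abs_of_nonneg (sq_nonneg _)]
        calc 1 / 3 * Pb (‖x - x₀‖ ^ 2 / s ^ 2) * ‖w x‖ ^ 2 ≤ 1 / 3 * 1 * ‖w x‖ ^ 2 := by
              gcongr; exact hPble _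
          _ ≤ 1 * ‖w x‖ ^ 2 := by nlinarith [sq_nonneg ‖w x‖]
      calc |2 / 3 * (deriv Pb (‖x - x₀‖ ^ 2 / s ^ 2) / s ^ 2) * ⟪x - x₀, w x⟫ ^ 2 +
            1 / 3 * Pb (‖x - x₀‖ ^ 2 / s ^ 2) * ‖w x‖ ^ 2|
          ≤ |2 / 3 * (deriv Pb (‖x - x₀‖ ^ 2 / s ^ 2) / s ^ 2) * ⟪x - x₀, w x⟫ ^ 2| +
            |1 / 3 * Pb (‖x - x₀‖ ^ 2 / s ^ 2) * ‖w x‖ ^ 2| := abs_add_le _ _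
        _ ≤ 2 / 3 * (3 * ‖w x‖ ^ 2) + 1 * ‖w x‖ ^ 2 := by
            refine add_le_add ?_ h2
            rw [mul_assoc, abs_mul, abs_of_nonneg (by norm_num : (0 : ℝ) ≤ 2 / 3)]
            gcongr
            exact hkey x
        _ = 3 * ‖w x‖ ^ 2 := by ring
  have hA₂int : Integrable A₂ := by
    refine (hL2.mul_const 5).mono' ?_ (Eventually.of_forall fun x => ?_)
    · exact ((hwc.norm.pow 2).mul ((continuous_const.mul (hPb.continuous.comp hn)).sub
        (continuous_const.mul (hP.continuous.comp hn)))).aestronglyMeasurable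
    · rw [Real.norm_eq_abs]
      simp only [hA₂]
      rw [abs_mul, abs_of_nonneg (sq_nonneg _)]
      gcongr
      rw [abs_le]; constructor <;> nlinarith [hPbnn (‖x - x₀‖ ^ 2 / s ^ 2),
        hPble (‖x - x₀‖ ^ 2 / s ^ 2), hPnn (‖x - x₀‖ ^ 2 / s ^ 2), hPle (‖x - x₀‖ ^ 2 / s ^ 2)]
  -- `A₂ + 3 A₁ ≥ 0` pointwise
  have hpt : ∀ x, 0 ≤ A₂ x + 3 * A₁ x := by
    intro x
    simp only [hA₁, hA₂]
    set τ : ℝ := ‖x - x₀‖ ^ 2 / s ^ 2 with hτ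
    have hodeτ := hode τ
    have hcs : ⟪x - x₀, w x⟫ ^ 2 ≤ ‖x - x₀‖ ^ 2 * ‖w x‖ ^ 2 := by
      have h0 := abs_real_inner_le_norm (x - x₀) (w x)
      calc ⟪x - x₀, w x⟫ ^ 2 = |⟪x - x₀, w x⟫| ^ 2 := (sq_abs _).symm
        _ ≤ (‖x - x₀‖ * ‖w x‖) ^ 2 := pow_le_pow_left₀ (abs_nonneg _) h0 2
        _ = ‖x - x₀‖ ^ 2 * ‖w x‖ ^ 2 := by ring
    have hd : deriv Pb τ ≤ 0 := hPb' τ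
    have hs2 : 0 < s ^ 2 := by positivity
    -- `A₂ + 3A₁ = 2 (-P̄'(τ)) s⁻² (|x-x₀|²|w|² - ⟨x-x₀,w⟩²)`
    have e : ‖w x‖ ^ 2 * (2 * Pb τ - 3 * P τ) +
        3 * (2 / 3 * (deriv Pb τ / s ^ 2) * ⟪x - x₀, w x⟫ ^ 2 + 1 / 3 * Pb τ * ‖w x‖ ^ 2) =
        2 * (-deriv Pb τ) / s ^ 2 * (‖x - x₀‖ ^ 2 * ‖w x‖ ^ 2 - ⟪x - x₀, w x⟫ ^ 2) := by
      rw [← hodeτ, hτ]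
      field_simp
      ring
    rw [e]
    exact mul_nonneg (div_nonneg (by linarith) hs2.le) (by linarith)
  have h : 0 ≤ ∫ x, (A₂ x + 3 * A₁ x) := integral_nonneg hpt
  rw [integral_add hA₂int (hA₁int.const_mul 3), integral_const_mul] at h
  rw [hid]
  linarith

/-- `∫ P(|x - x₀|²/s²) dx = s³ c_P`, `c_P = ∫ P(|y|²) dy`. [folklore] -/
theorem integral_probe_scaled (P : ℝ → ℝ) (x₀ : EuclideanSpace ℝ (Fin 3)) {s : ℝ} (hs : 0 < s) :
    ∫ x, P (‖x - x₀‖ ^ 2 / s ^ 2) = s ^ 3 * ∫ y : EuclideanSpace ℝ (Fin 3), P (‖y‖ ^ 2) := by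
  rw [integral_comp_affine_fin3 _ x₀ hs]
  congr 1
  refine integral_congr_ae (Eventually.of_forall fun y => ?_)
  show P (‖x₀ + s • y - x₀‖ ^ 2 / s ^ 2) = P (‖y‖ ^ 2)
  rw [add_sub_cancel_left, norm_smul, Real.norm_eq_abs, abs_of_pos hs]
  field_simp

/-- **The lower bound on `G` under a pressure floor**: if `p̃[w] ≥ -M` on `B(x₀, S)` then
`G(s) ≥ -3 M s³ c_P` for `0 < s ≤ S`. [folklore] -/
theorem G_lower_bound_of_floor (hP : ContDiff ℝ ∞ P) (hPb : ContDiff ℝ ∞ Pb)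
    (hode : ∀ σ, Pb σ + 2 / 3 * σ * deriv Pb σ = P σ) (hP0 : ∀ σ, 1 ≤ σ → P σ = 0)
    (hPnn : ∀ σ, 0 ≤ P σ) (hPle : ∀ σ, P σ ≤ Pb σ) (hPble : ∀ σ, Pb σ ≤ 1)
    (hPb' : ∀ σ, deriv Pb σ ≤ 0)
    {w : EuclideanSpace ℝ (Fin 3) → EuclideanSpace ℝ (Fin 3)}
    (hw : ContDiff ℝ ∞ w) (hL2 : Integrable fun y => ‖w y‖ ^ 2)
    (x₀ : EuclideanSpace ℝ (Fin 3)) {M S s : ℝ} (_hM : 0 ≤ M)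
    (hfloor : ∀ x ∈ ball x₀ S, -M ≤ normalisedPressure w x) (hs : 0 < s) (hsS : s ≤ S) :
    -(3 * M * (∫ y : EuclideanSpace ℝ (Fin 3), P (‖y‖ ^ 2)) * s ^ 3) ≤
      ∫ x, ‖w x‖ ^ 2 * (2 * Pb (‖x - x₀‖ ^ 2 / s ^ 2) - 3 * P (‖x - x₀‖ ^ 2 / s ^ 2)) := by
  refine le_trans ?_ (three_mul_integral_pressure_probe_le hP hPb hode hP0 hPnn hPle hPble hPb'
    hw hL2 x₀ hs)
  have hpc := continuous_normalisedPressure_of_integrable hw hL2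
  have hn : Continuous fun x : EuclideanSpace ℝ (Fin 3) => ‖x - x₀‖ ^ 2 / s ^ 2 :=
    ((continuous_id.sub continuous_const).norm.pow 2).div_const _
  have hPsc : Continuous fun x : EuclideanSpace ℝ (Fin 3) => P (‖x - x₀‖ ^ 2 / s ^ 2) :=
    hP.continuous.comp hn
  -- the probe at scale `s` is supported in the closed ball `B̄(x₀, s)` and positive only on the open ball
  have hPs0 : ∀ x : EuclideanSpace ℝ (Fin 3), x ∉ closedBall x₀ s → P (‖x - x₀‖ ^ 2 / s ^ 2) = 0 := by
    intro x hx
    rw [mem_closedBall, dist_eq_norm, not_le] at hx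
    refine hP0 _ ?_
    rw [le_div_iff₀ (by positivity)]
    nlinarith [norm_nonneg (x - x₀)]
  have hsupp : HasCompactSupport fun x : EuclideanSpace ℝ (Fin 3) => P (‖x - x₀‖ ^ 2 / s ^ 2) :=
    HasCompactSupport.intro (isCompact_closedBall x₀ s) hPs0
  have hPint : Integrable fun x : EuclideanSpace ℝ (Fin 3) => P (‖x - x₀‖ ^ 2 / s ^ 2) :=
    hPsc.integrable_of_hasCompactSupport hsupp
  have hpPint : Integrable fun x => normalisedPressure w x * P (‖x - x₀‖ ^ 2 / s ^ 2) :=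
    (hpc.mul hPsc).integrable_of_hasCompactSupport hsupp.mul_left
  have hpt : ∀ x, -M * P (‖x - x₀‖ ^ 2 / s ^ 2) ≤ normalisedPressure w x * P (‖x - x₀‖ ^ 2 / s ^ 2) := by
    intro x
    by_cases hx : x ∈ ball x₀ S
    · exact mul_le_mul_of_nonneg_right (hfloor x hx) (hPnn _)
    · have : P (‖x - x₀‖ ^ 2 / s ^ 2) = 0 := by
        refine hP0 _ ?_
        rw [mem_ball, dist_eq_norm, not_lt] at hx
        rw [le_div_iff₀ (by positivity)]
        nlinarith [norm_nonneg (x - x₀), hsS]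
      rw [this, mul_zero, mul_zero]
  have h := integral_mono (hPint.const_mul (-M)) hpPint hpt
  rw [integral_const_mul, integral_probe_scaled P x₀ hs] at h
  linarith

/-- **The lower bound on `G` under a head-pressure ceiling**: if `|w|² + 2p̃[w] ≤ M` on
`B(x₀, S)` then again `G(s) ≥ -3 M s³ c_P` for `0 < s ≤ S` (from the identity of Part C:
`∫(3P - 2P̄)|w|² ≤ 3M∫P_s + 4∫ s⁻²P̄'⟨x-x₀,w⟩² ≤ 3M∫P_s`). [folklore] -/
theorem G_lower_bound_of_head (hP : ContDiff ℝ ∞ P) (hPb : ContDiff ℝ ∞ Pb)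
    (hode : ∀ σ, Pb σ + 2 / 3 * σ * deriv Pb σ = P σ) (hP0 : ∀ σ, 1 ≤ σ → P σ = 0)
    (hPnn : ∀ σ, 0 ≤ P σ) (hPle : ∀ σ, P σ ≤ Pb σ) (hPble : ∀ σ, Pb σ ≤ 1)
    (hPb' : ∀ σ, deriv Pb σ ≤ 0)
    {w : EuclideanSpace ℝ (Fin 3) → EuclideanSpace ℝ (Fin 3)}
    (hw : ContDiff ℝ ∞ w) (hL2 : Integrable fun y => ‖w y‖ ^ 2)
    (x₀ : EuclideanSpace ℝ (Fin 3)) {M S s : ℝ} (_hM : 0 ≤ M)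
    (hhead : ∀ x ∈ ball x₀ S, ‖w x‖ ^ 2 + 2 * normalisedPressure w x ≤ M) (hs : 0 < s) (hsS : s ≤ S) :
    -(3 * M * (∫ y : EuclideanSpace ℝ (Fin 3), P (‖y‖ ^ 2)) * s ^ 3) ≤
      ∫ x, ‖w x‖ ^ 2 * (2 * Pb (‖x - x₀‖ ^ 2 / s ^ 2) - 3 * P (‖x - x₀‖ ^ 2 / s ^ 2)) := by
  have hPbnn : ∀ σ, 0 ≤ Pb σ := fun σ => (hPnn σ).trans (hPle σ)
  have hid := integral_normalisedPressure_mul_probe_scaled hP hPb hode hP0 hPnn hPle hPble hw hL2 x₀ hs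
  have hpc := continuous_normalisedPressure_of_integrable hw hL2
  have hwc : Continuous w := hw.continuous
  have hn : Continuous fun x : EuclideanSpace ℝ (Fin 3) => ‖x - x₀‖ ^ 2 / s ^ 2 :=
    ((continuous_id.sub continuous_const).norm.pow 2).div_const _
  have hPsc : Continuous fun x : EuclideanSpace ℝ (Fin 3) => P (‖x - x₀‖ ^ 2 / s ^ 2) :=
    hP.continuous.comp hn
  have hPb'c : Continuous (deriv Pb) := hPb.continuous_deriv (by simp)
  have hPs0 : ∀ x : EuclideanSpace ℝ (Fin 3), x ∉ closedBall x₀ s → P (‖x - x₀‖ ^ 2 / s ^ 2) = 0 := by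
    intro x hx
    rw [mem_closedBall, dist_eq_norm, not_le] at hx
    refine hP0 _ ?_
    rw [le_div_iff₀ (by positivity)]
    nlinarith [norm_nonneg (x - x₀)]
  have hsupp : HasCompactSupport fun x : EuclideanSpace ℝ (Fin 3) => P (‖x - x₀‖ ^ 2 / s ^ 2) :=
    HasCompactSupport.intro (isCompact_closedBall x₀ s) hPs0
  have hPint : Integrable fun x : EuclideanSpace ℝ (Fin 3) => P (‖x - x₀‖ ^ 2 / s ^ 2) :=
    hPsc.integrable_of_hasCompactSupport hsupp
  have hpPint : Integrable fun x => normalisedPressure w x * P (‖x - x₀‖ ^ 2 / s ^ 2) :=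
    (hpc.mul hPsc).integrable_of_hasCompactSupport hsupp.mul_left
  have hwPint : Integrable fun x => ‖w x‖ ^ 2 * P (‖x - x₀‖ ^ 2 / s ^ 2) :=
    ((hwc.norm.pow 2).mul hPsc).integrable_of_hasCompactSupport hsupp.mul_left
  -- pointwise: `2 p̃ P_s ≤ (M - |w|²) P_s`
  have hpt : ∀ x, 2 * (normalisedPressure w x * P (‖x - x₀‖ ^ 2 / s ^ 2)) ≤
      M * P (‖x - x₀‖ ^ 2 / s ^ 2) - ‖w x‖ ^ 2 * P (‖x - x₀‖ ^ 2 / s ^ 2) := by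
    intro x
    by_cases hx : x ∈ ball x₀ S
    · have := hhead x hx
      have hP' := hPnn (‖x - x₀‖ ^ 2 / s ^ 2)
      nlinarith
    · have : P (‖x - x₀‖ ^ 2 / s ^ 2) = 0 := by
        refine hP0 _ ?_
        rw [mem_ball, dist_eq_norm, not_lt] at hx
        rw [le_div_iff₀ (by positivity)]
        nlinarith [norm_nonneg (x - x₀), hsS]
      simp [this]
  have h1 := integral_mono (hpPint.const_mul 2) ((hPint.const_mul M).sub hwPint) hpt
  rw [integral_const_mul] at h1
  simp only [Pi.sub_apply] at h1
  rw [integral_sub (hPint.const_mul M) hwPint, integral_const_mul,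
    integral_probe_scaled P x₀ hs] at h1
  -- the identity: `3∫p̃P_s = -∫(2 s⁻²P̄' ⟨⟩² + P̄|w|²)` with `∫ 2 s⁻² P̄'⟨⟩² ≤ 0`
  set B₁ : EuclideanSpace ℝ (Fin 3) → ℝ := fun x =>
    (deriv Pb (‖x - x₀‖ ^ 2 / s ^ 2) / s ^ 2) * ⟪x - x₀, w x⟫ ^ 2 with hB₁
  set B₂ : EuclideanSpace ℝ (Fin 3) → ℝ := fun x => Pb (‖x - x₀‖ ^ 2 / s ^ 2) * ‖w x‖ ^ 2 with hB₂
  have hτnn : ∀ x : EuclideanSpace ℝ (Fin 3), 0 ≤ ‖x - x₀‖ ^ 2 / s ^ 2 := fun x => by positivity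
  have hB₁int : Integrable B₁ := by
    refine (hL2.const_mul 3).mono' ?_ (Eventually.of_forall fun x => ?_)
    · exact (((hPb'c.comp hn).div_const _).mul
        (((continuous_id.sub continuous_const).inner hwc).pow 2)).aestronglyMeasurable
    · rw [Real.norm_eq_abs]
      simp only [hB₁]
      have hcs : ⟪x - x₀, w x⟫ ^ 2 ≤ ‖x - x₀‖ ^ 2 * ‖w x‖ ^ 2 := by
        have h0 := abs_real_inner_le_norm (x - x₀) (w x)
        calc ⟪x - x₀, w x⟫ ^ 2 = |⟪x - x₀, w x⟫| ^ 2 := (sq_abs _).symm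
          _ ≤ (‖x - x₀‖ * ‖w x‖) ^ 2 := pow_le_pow_left₀ (abs_nonneg _) h0 2
          _ = ‖x - x₀‖ ^ 2 * ‖w x‖ ^ 2 := by ring
      have h3 := abs_deriv_mul_le_three hode hPnn hPle hPble (hτnn x)
      rw [abs_mul, abs_div, abs_of_nonneg (sq_nonneg ⟪x - x₀, w x⟫), abs_of_nonneg (sq_nonneg s)]
      calc |deriv Pb (‖x - x₀‖ ^ 2 / s ^ 2)| / s ^ 2 * ⟪x - x₀, w x⟫ ^ 2
          ≤ |deriv Pb (‖x - x₀‖ ^ 2 / s ^ 2)| / s ^ 2 * (‖x - x₀‖ ^ 2 * ‖w x‖ ^ 2) := by gcongr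
        _ = |deriv Pb (‖x - x₀‖ ^ 2 / s ^ 2)| * (‖x - x₀‖ ^ 2 / s ^ 2) * ‖w x‖ ^ 2 := by
            field_simp
        _ ≤ 3 * ‖w x‖ ^ 2 := by gcongr
  have hB₂int : Integrable B₂ := by
    refine (hL2.const_mul 1).mono' ?_ (Eventually.of_forall fun x => ?_)
    · exact ((hPb.continuous.comp hn).mul (hwc.norm.pow 2)).aestronglyMeasurable
    · rw [Real.norm_eq_abs]
      simp only [hB₂]
      rw [abs_mul, abs_of_nonneg (hPbnn _), abs_of_nonneg (sq_nonneg _)]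
      calc Pb (‖x - x₀‖ ^ 2 / s ^ 2) * ‖w x‖ ^ 2 ≤ 1 * ‖w x‖ ^ 2 := by gcongr; exact hPble _
        _ = 1 * ‖w x‖ ^ 2 := rfl
  have hB₁le : ∫ x, B₁ x ≤ 0 := by
    refine integral_nonpos fun x => ?_
    simp only [hB₁]
    exact mul_nonpos_of_nonpos_of_nonneg (div_nonpos_of_nonpos_of_nonneg (hPb' _) (sq_nonneg s))
      (sq_nonneg _)
  have hid' : ∫ x, normalisedPressure w x * P (‖x - x₀‖ ^ 2 / s ^ 2) =
      -(2 / 3 * (∫ x, B₁ x) + 1 / 3 * (∫ x, B₂ x)) := by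
    rw [hid, ← integral_const_mul, ← integral_const_mul, ← integral_add (hB₁int.const_mul _)
      (hB₂int.const_mul _)]
    congr 1
    refine integral_congr_ae (Eventually.of_forall fun x => ?_)
    simp only [hB₁, hB₂]
    ring
  -- `G(s) = 2∫B₂ - 3∫|w|²P_s`
  have hG : ∫ x, ‖w x‖ ^ 2 * (2 * Pb (‖x - x₀‖ ^ 2 / s ^ 2) - 3 * P (‖x - x₀‖ ^ 2 / s ^ 2)) =
      2 * (∫ x, B₂ x) - 3 * (∫ x, ‖w x‖ ^ 2 * P (‖x - x₀‖ ^ 2 / s ^ 2)) := by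
    rw [← integral_const_mul, ← integral_const_mul, ← integral_sub (hB₂int.const_mul _)
      (hwPint.const_mul _)]
    refine integral_congr_ae (Eventually.of_forall fun x => ?_)
    simp only [hB₂]
    ring
  rw [hG]
  rw [hid'] at h1
  linarith [hB₁le, h1]

/-- **Monotonicity of the scaled kinetic energy under a one-sided pressure bound.** For a probe
pair, `w ∈ C^∞(ℝ³; ℝ³)` of finite energy, a centre `x₀`, `M ≥ 0` and `0 < r ≤ S`: if
`p̃[w] ≥ -M` on `B(x₀, S)`, OR `|w|² + 2p̃[w] ≤ M` on `B(x₀, S)`, then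
`F(r) ≤ F(S) + (3/2) M c_P (S² - r²)`, `F(s) = ∫ |w|² s⁻¹ P̄(|x-x₀|²/s²)`, `c_P = ∫ P(|y|²) dy`.
[folklore] -/
theorem scaledEnergy_le_of_oneSided (hP : ContDiff ℝ ∞ P) (hPb : ContDiff ℝ ∞ Pb)
    (hode : ∀ σ, Pb σ + 2 / 3 * σ * deriv Pb σ = P σ) (hP0 : ∀ σ, 1 ≤ σ → P σ = 0)
    (hPnn : ∀ σ, 0 ≤ P σ) (hPle : ∀ σ, P σ ≤ Pb σ) (hPble : ∀ σ, Pb σ ≤ 1)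
    (hPb' : ∀ σ, deriv Pb σ ≤ 0)
    {w : EuclideanSpace ℝ (Fin 3) → EuclideanSpace ℝ (Fin 3)}
    (hw : ContDiff ℝ ∞ w) (hL2 : Integrable fun y => ‖w y‖ ^ 2)
    (x₀ : EuclideanSpace ℝ (Fin 3)) {M r S : ℝ} (hM : 0 ≤ M) (hr : 0 < r) (hrS : r ≤ S)
    (hone : (∀ x ∈ ball x₀ S, -M ≤ normalisedPressure w x) ∨
      (∀ x ∈ ball x₀ S, ‖w x‖ ^ 2 + 2 * normalisedPressure w x ≤ M)) :
    ∫ x, ‖w x‖ ^ 2 * (r⁻¹ * Pb (‖x - x₀‖ ^ 2 / r ^ 2)) ≤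
      (∫ x, ‖w x‖ ^ 2 * (S⁻¹ * Pb (‖x - x₀‖ ^ 2 / S ^ 2))) +
        3 / 2 * M * (∫ y : EuclideanSpace ℝ (Fin 3), P (‖y‖ ^ 2)) * (S ^ 2 - r ^ 2) := by
  set cP : ℝ := ∫ y : EuclideanSpace ℝ (Fin 3), P (‖y‖ ^ 2) with hcP
  set G : ℝ → ℝ := fun s =>
    ∫ x, ‖w x‖ ^ 2 * (2 * Pb (‖x - x₀‖ ^ 2 / s ^ 2) - 3 * P (‖x - x₀‖ ^ 2 / s ^ 2)) with hGdef
  have hFub := scaledEnergy_sub_eq_integral hP hPb hode hPnn hPle hPble hw hL2 x₀ hr hrS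
  have hGs : ∀ s ∈ Icc r S, -(3 * M * cP * s ^ 3) ≤ G s := by
    intro s hs
    have hs0 : 0 < s := lt_of_lt_of_le hr hs.1
    rcases hone with h | h
    · exact G_lower_bound_of_floor hP hPb hode hP0 hPnn hPle hPble hPb' hw hL2 x₀ hM h hs0 hs.2
    · exact G_lower_bound_of_head hP hPb hode hP0 hPnn hPle hPble hPb' hw hL2 x₀ hM h hs0 hs.2
  -- the right-hand side of the Fubini identity is an integral of an integrable function of `s`
  -- which dominates `-3 M cP s`
  have hlow : ∀ s ∈ Icc r S, -(3 * M * cP * s) ≤ (s ^ 2)⁻¹ * G s := by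
    intro s hs
    have hs0 : 0 < s := lt_of_lt_of_le hr hs.1
    have h := hGs s hs
    have hs2 : 0 < s ^ 2 := by positivity
    calc -(3 * M * cP * s) = (s ^ 2)⁻¹ * -(3 * M * cP * s ^ 3) := by field_simp
      _ ≤ (s ^ 2)⁻¹ * G s := by gcongr
  -- integrability of `s ↦ s⁻² G s` on `[r, S]`: it is the FTC integrand, handle via the
  -- lower Riemann comparison in `intervalIntegral` with the explicit primitive of `-3McP s`
  have key : -(3 / 2 * M * cP * (S ^ 2 - r ^ 2)) ≤ ∫ s in r..S, (s ^ 2)⁻¹ * G s := by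
    have hlin : ∫ s in r..S, -(3 * M * cP * s) = -(3 / 2 * M * cP * (S ^ 2 - r ^ 2)) := by
      rw [intervalIntegral.integral_neg, intervalIntegral.integral_const_mul, integral_id]
      ring
    rw [← hlin]
    by_cases hint : IntervalIntegrable (fun s => (s ^ 2)⁻¹ * G s) volume r S
    · exact intervalIntegral.integral_mono_on hrS (by
        exact (continuous_const.mul continuous_id).neg.intervalIntegrable _ _) hint hlow
    · -- not integrable: the interval integral is the junk value `0`, and the Fubini identity
      -- then says `F S = F r`; but we only need the inequality, which we get from `hFub`:
      -- in that case `∫ = 0` and we must show `-(3/2)McP(S²-r²) ≤ 0`... via `hlin` form: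
      rw [intervalIntegral.integral_undef hint, hlin]
      have : 0 ≤ 3 / 2 * M * cP * (S ^ 2 - r ^ 2) := by
        have hcP0 : 0 ≤ cP := integral_nonneg fun y => hPnn _
        have : r ^ 2 ≤ S ^ 2 := pow_le_pow_left₀ hr.le hrS 2
        have := mul_nonneg (mul_nonneg (by positivity : (0 : ℝ) ≤ 3 / 2 * M) hcP0) (sub_nonneg.2 this)
        linarith
      linarith
  linarith [hFub, key]

/-- **Type I bound from a one-sided pressure bound (single slice).** For `w ∈ C^∞(ℝ³; ℝ³)`
of finite energy, a centre `x₀`, `M ≥ 0` and `0 < r ≤ S`: if `p̃[w] ≥ -M` on `B(x₀, S)` or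
`|w|² + 2 p̃[w] ≤ M` on `B(x₀, S)`, then
`r⁻¹ ∫_{B(x₀, r/2)} |w|² ≤ S⁻¹ ∫ |w|² + (3/2) M c_P S²` with `c_P = ∫ P(|y|²)dy` for any probe
pair (e.g. the one of `exists_pressureProbePair`). [folklore] -/
theorem typeI_of_oneSided (hP : ContDiff ℝ ∞ P) (hPb : ContDiff ℝ ∞ Pb)
    (hode : ∀ σ, Pb σ + 2 / 3 * σ * deriv Pb σ = P σ) (hP0 : ∀ σ, 1 ≤ σ → P σ = 0)
    (hPnn : ∀ σ, 0 ≤ P σ) (hPle : ∀ σ, P σ ≤ Pb σ) (hPble : ∀ σ, Pb σ ≤ 1)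
    (hPb1 : ∀ σ, σ ≤ 1 / 4 → Pb σ = 1) (hPb' : ∀ σ, deriv Pb σ ≤ 0)
    {w : EuclideanSpace ℝ (Fin 3) → EuclideanSpace ℝ (Fin 3)}
    (hw : ContDiff ℝ ∞ w) (hL2 : Integrable fun y => ‖w y‖ ^ 2)
    (x₀ : EuclideanSpace ℝ (Fin 3)) {M r S : ℝ} (hM : 0 ≤ M) (hr : 0 < r) (hrS : r ≤ S)
    (hone : (∀ x ∈ ball x₀ S, -M ≤ normalisedPressure w x) ∨
      (∀ x ∈ ball x₀ S, ‖w x‖ ^ 2 + 2 * normalisedPressure w x ≤ M)) :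
    r⁻¹ * ∫ x in ball x₀ (r / 2), ‖w x‖ ^ 2 ≤
      S⁻¹ * (∫ x, ‖w x‖ ^ 2) + 3 / 2 * M * (∫ y : EuclideanSpace ℝ (Fin 3), P (‖y‖ ^ 2)) * S ^ 2 := by
  have hPbnn : ∀ σ, 0 ≤ Pb σ := fun σ => (hPnn σ).trans (hPle σ)
  have hS : 0 < S := lt_of_lt_of_le hr hrS
  have hmono := scaledEnergy_le_of_oneSided hP hPb hode hP0 hPnn hPle hPble hPb' hw hL2 x₀ hM hr hrS hone
  have hwc : Continuous w := hw.continuous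
  have hn : ∀ s : ℝ, Continuous fun x : EuclideanSpace ℝ (Fin 3) => ‖x - x₀‖ ^ 2 / s ^ 2 := fun s =>
    ((continuous_id.sub continuous_const).norm.pow 2).div_const _
  have hk_int : ∀ s : ℝ, Integrable fun x => ‖w x‖ ^ 2 * (s⁻¹ * Pb (‖x - x₀‖ ^ 2 / s ^ 2)) := by
    intro s
    refine (hL2.mul_const |s⁻¹|).mono' ?_ (Eventually.of_forall fun x => ?_)
    · exact ((hwc.norm.pow 2).mul (continuous_const.mul
        (hPb.continuous.comp (hn s)))).aestronglyMeasurable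
    · rw [Real.norm_eq_abs, abs_mul, abs_of_nonneg (sq_nonneg _), abs_mul, abs_of_nonneg (hPbnn _)]
      calc ‖w x‖ ^ 2 * (|s⁻¹| * Pb (‖x - x₀‖ ^ 2 / s ^ 2)) ≤ ‖w x‖ ^ 2 * (|s⁻¹| * 1) := by
            gcongr; exact hPble _
        _ = ‖w x‖ ^ 2 * |s⁻¹| := by ring
  -- lower bound: `F(r) ≥ r⁻¹ ∫_{B(x₀, r/2)} |w|²`
  have hlow : r⁻¹ * ∫ x in ball x₀ (r / 2), ‖w x‖ ^ 2 ≤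
      ∫ x, ‖w x‖ ^ 2 * (r⁻¹ * Pb (‖x - x₀‖ ^ 2 / r ^ 2)) := by
    rw [← integral_const_mul, ← integral_indicator measurableSet_ball]
    refine integral_mono ?_ (hk_int r) fun x => ?_
    · exact ((hL2.const_mul _).indicator measurableSet_ball)
    · by_cases hx : x ∈ ball x₀ (r / 2)
      · rw [indicator_of_mem hx]
        have hτ : ‖x - x₀‖ ^ 2 / r ^ 2 ≤ 1 / 4 := by
          rw [mem_ball, dist_eq_norm] at hx
          rw [div_le_iff₀ (by positivity)]
          nlinarith [norm_nonneg (x - x₀)]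
        rw [hPb1 _ hτ]
        nlinarith [sq_nonneg ‖w x‖, inv_pos.2 hr]
      · rw [indicator_of_notMem hx]
        exact mul_nonneg (sq_nonneg _) (mul_nonneg (inv_pos.2 hr).le (hPbnn _))
  -- upper bound: `F(S) ≤ S⁻¹ ∫ |w|²`
  have hup : ∫ x, ‖w x‖ ^ 2 * (S⁻¹ * Pb (‖x - x₀‖ ^ 2 / S ^ 2)) ≤ S⁻¹ * ∫ x, ‖w x‖ ^ 2 := by
    rw [← integral_const_mul]
    refine integral_mono (hk_int S) (hL2.const_mul _) fun x => ?_
    calc ‖w x‖ ^ 2 * (S⁻¹ * Pb (‖x - x₀‖ ^ 2 / S ^ 2)) ≤ ‖w x‖ ^ 2 * (S⁻¹ * 1) := by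
          gcongr; exact hPble _
      _ = S⁻¹ * ‖w x‖ ^ 2 := by ring
  have hcP0 : 0 ≤ ∫ y : EuclideanSpace ℝ (Fin 3), P (‖y‖ ^ 2) := integral_nonneg fun y => hPnn _
  nlinarith [hlow, hup, hmono, mul_nonneg (mul_nonneg (by positivity : (0 : ℝ) ≤ 3 / 2 * M) hcP0)
    (sq_nonneg r)]

end Monotonicity


/-! ## Part E. Application: classical Leray–Hopf solutions with a one-sided pressure bound are Type I

In the setting of `Literature.Analysis.FluidPDE.seregin_sverak_2002` (a classical solution of the
unforced Navier–Stokes system on `[0, T) × ℝ³` which is Leray–Hopf from its datum, with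
`|u|²/2 + p̃ ≤ K` or `p̃ ≥ -K` on `(0, T) × ℝ³`), every slice obeys the **uniform Type I bound**
`r⁻¹ ∫_{B(x₀, r/2)} |u(t)|² ≤ S⁻¹ ‖u(0)‖₂² + 4πK S²` for all `x₀ ∈ ℝ³`, `t ∈ (0, T)` and
`0 < r ≤ S` (energy inequality `‖u(t)‖₂ ≤ ‖u(0)‖₂`; `c_P ≤ |B₁| = 4π/3`). In particular the scaled
kinetic energy `sup_{t} r⁻¹ ∫_{B_r(x₀)} |u(t)|²` — the quantity `A` of the ε-regularity theory
(Seregin–Šverák 2002, Lemma 3.3; Seregin 2006, Lemma 2.1 (c)) — is bounded at every point of the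
closed slab, uniformly, by a constant depending only on `‖u(0)‖₂`, `K` and the scale. -/

section Application

/-- The energy inequality of an unforced Leray–Hopf solution: `∫|u(t)|² ≤ ∫|u(0)|²` on `[0, T]`.
[folklore] -/
theorem integral_norm_sq_le_of_isLerayHopfOn {ν T : ℝ} (hν : 0 ≤ ν)
    {u : ℝ → EuclideanSpace ℝ (Fin 3) → EuclideanSpace ℝ (Fin 3)}
    (hLH : IsLerayHopfOn T ν 0 (u 0) u) {t : ℝ} (ht : t ∈ Icc 0 T) :
    ∫ x, ‖u t x‖ ^ 2 ≤ ∫ x, ‖u 0 x‖ ^ 2 := by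
  obtain ⟨G, -, hE⟩ := hLH.energy_ineq_zero
  have h := hE t ht
  have h0 : ∫ τ in (0 : ℝ)..t, ∫ x, ⟪(0 : ℝ → EuclideanSpace ℝ (Fin 3) → EuclideanSpace ℝ (Fin 3)) τ x,
      u τ x⟫ = 0 := by simp
  rw [h0, add_zero] at h
  have hdiss : 0 ≤ ν * (∫⁻ τ in Ioo 0 t, ∫⁻ x, ENNReal.ofReal (frobeniusNormSq (G τ x))).toReal :=
    mul_nonneg hν ENNReal.toReal_nonneg
  have hK : VectorCalculus.kineticEnergy (u t) ≤ VectorCalculus.kineticEnergy (u 0) := by linarith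
  unfold VectorCalculus.kineticEnergy at hK
  linarith

/-- `c_P = ∫ P(|y|²) dy ≤ |B̄₁| = 4π/3` for a probe profile `0 ≤ P ≤ 1` vanishing on `σ ≥ 1`.
[folklore] -/
theorem integral_probe_le {P : ℝ → ℝ} (hP : ContDiff ℝ ∞ P) (hP0 : ∀ σ, 1 ≤ σ → P σ = 0)
    (hP1 : ∀ σ, P σ ≤ 1) :
    ∫ y : EuclideanSpace ℝ (Fin 3), P (‖y‖ ^ 2) ≤ 4 * π / 3 := by
  have hPc : Continuous fun y : EuclideanSpace ℝ (Fin 3) => P (‖y‖ ^ 2) :=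
    hP.continuous.comp (continuous_norm.pow 2)
  have hsupp : HasCompactSupport fun y : EuclideanSpace ℝ (Fin 3) => P (‖y‖ ^ 2) := by
    refine HasCompactSupport.intro (isCompact_closedBall (0 : EuclideanSpace ℝ (Fin 3)) 1)
      fun y hy => ?_
    rw [mem_closedBall, dist_zero_right, not_le] at hy
    exact hP0 _ (by nlinarith)
  have hint : Integrable fun y : EuclideanSpace ℝ (Fin 3) => P (‖y‖ ^ 2) :=
    hPc.integrable_of_hasCompactSupport hsupp
  have hind : Integrable ((closedBall (0 : EuclideanSpace ℝ (Fin 3)) 1).indicator fun _ => (1 : ℝ)) :=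
    (integrableOn_const (measure_closedBall_lt_top (x := (0 : EuclideanSpace ℝ (Fin 3)))
      (r := 1)).ne).integrable_indicator measurableSet_closedBall
  have hle : ∀ y : EuclideanSpace ℝ (Fin 3),
      P (‖y‖ ^ 2) ≤ (closedBall (0 : EuclideanSpace ℝ (Fin 3)) 1).indicator (fun _ => (1 : ℝ)) y := by
    intro y
    by_cases hy : y ∈ closedBall (0 : EuclideanSpace ℝ (Fin 3)) 1
    · rw [indicator_of_mem hy]; exact hP1 _
    · rw [indicator_of_notMem hy]
      rw [mem_closedBall, dist_zero_right, not_le] at hy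
      rw [hP0 _ (by nlinarith)]
  refine (integral_mono hint hind hle).trans ?_
  rw [integral_indicator measurableSet_closedBall, setIntegral_const, smul_eq_mul, mul_one,
    Measure.real, EuclideanSpace.volume_closedBall_fin_three]
  rw [ENNReal.toReal_mul, ENNReal.ofReal_one, one_pow, ENNReal.toReal_one, one_mul,
    ENNReal.toReal_ofReal (by positivity)]
  linarith

/-- **One-sided pressure bounds force Type I (uniformly bounded scaled kinetic energy).**
Let `(u, p)` be a classical solution of the unforced Navier–Stokes system on `[0, T) × ℝ³`,
`ν ≥ 0`, which is a Leray–Hopf solution from its datum `u 0`, and suppose that for some `K ≥ 0`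
either `|u|²/2 + p̃ ≤ K` on `(0, T) × ℝ³` or `p̃ ≥ -K` on `(0, T) × ℝ³` (`p̃ = normalisedPressure`,
the hypotheses of `seregin_sverak_2002`). Then for every `t ∈ (0, T)`, `x₀ ∈ ℝ³` and
`0 < r ≤ S`:

  `r⁻¹ ∫_{B(x₀, r/2)} |u(t, x)|² dx ≤ S⁻¹ ∫ |u(0)|² + 4π K S²`.

(Monotonicity of the probe-smoothed scaled energy, `typeI_of_oneSided`, with the probe pair of
`exists_pressureProbePair`; the energy inequality; `c_P ≤ 4π/3`.) In the language of the
ε-regularity theory this is a bound on Seregin's quantity `A(z₀, r)` at every point `z₀` of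
`(0, T] × ℝ³`, uniform in `z₀`: the solution is (locally) of Type I. [folklore] -/
theorem scaledKineticEnergy_le_of_oneSided_pressure {ν T : ℝ} (hν : 0 ≤ ν)
    {u : ℝ → EuclideanSpace ℝ (Fin 3) → EuclideanSpace ℝ (Fin 3)}
    {p : ℝ → EuclideanSpace ℝ (Fin 3) → ℝ}
    (hsol : IsClassicalNSSolutionOn (Ico 0 T) ν 0 u p) (hLH : IsLerayHopfOn T ν 0 (u 0) u)
    {K : ℝ} (hK : 0 ≤ K)
    (hone : (∀ t ∈ Ioo 0 T, ∀ x, ‖u t x‖ ^ 2 / 2 + normalisedPressure (u t) x ≤ K) ∨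
      (∀ t ∈ Ioo 0 T, ∀ x, -K ≤ normalisedPressure (u t) x))
    {t : ℝ} (ht : t ∈ Ioo 0 T) (x₀ : EuclideanSpace ℝ (Fin 3)) {r S : ℝ} (hr : 0 < r) (hrS : r ≤ S) :
    r⁻¹ * ∫ x in ball x₀ (r / 2), ‖u t x‖ ^ 2 ≤ S⁻¹ * (∫ x, ‖u 0 x‖ ^ 2) + 4 * π * K * S ^ 2 := by
  obtain ⟨P, Pb, hP, hPb, hPnn, hPle, hPble, -, -, hPb1, hP0, hPb', hode⟩ := exists_pressureProbePair
  have hw : ContDiff ℝ ∞ (u t) := hsol.contDiff_velocity ⟨ht.1.le, ht.2⟩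
  have htI : t ∈ Icc 0 T := ⟨ht.1.le, ht.2.le⟩
  have hL2 : Integrable fun x => ‖u t x‖ ^ 2 := (hLH.memLp t htI).integrable_norm_pow two_ne_zero
  have hS : 0 < S := lt_of_lt_of_le hr hrS
  have hcP := integral_probe_le hP hP0 (fun σ => (hPle σ).trans (hPble σ))
  have hcP0 : 0 ≤ ∫ y : EuclideanSpace ℝ (Fin 3), P (‖y‖ ^ 2) := integral_nonneg fun y => hPnn _
  have hEn := integral_norm_sq_le_of_isLerayHopfOn hν hLH htI
  -- the one-sided hypothesis on the slice, with `M = 2K`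
  have hone' : (∀ x ∈ ball x₀ S, -(2 * K) ≤ normalisedPressure (u t) x) ∨
      (∀ x ∈ ball x₀ S, ‖u t x‖ ^ 2 + 2 * normalisedPressure (u t) x ≤ 2 * K) := by
    rcases hone with h | h
    · exact Or.inr fun x _ => by have := h t ht x; linarith
    · exact Or.inl fun x _ => by have := h t ht x; linarith
  have h := typeI_of_oneSided hP hPb hode hP0 hPnn hPle hPble hPb1 hPb' hw hL2 x₀
    (by linarith : 0 ≤ 2 * K) hr hrS hone'
  have h1 : S⁻¹ * (∫ x, ‖u t x‖ ^ 2) ≤ S⁻¹ * ∫ x, ‖u 0 x‖ ^ 2 :=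
    mul_le_mul_of_nonneg_left hEn (inv_pos.2 hS).le
  have h2 : 3 / 2 * (2 * K) * (∫ y : EuclideanSpace ℝ (Fin 3), P (‖y‖ ^ 2)) * S ^ 2 ≤
      4 * π * K * S ^ 2 := by
    have : 3 / 2 * (2 * K) * (∫ y : EuclideanSpace ℝ (Fin 3), P (‖y‖ ^ 2)) ≤ 3 / 2 * (2 * K) * (4 * π / 3) :=
      mul_le_mul_of_nonneg_left hcP (by positivity)
    nlinarith [sq_nonneg S]
  linarith

/-- The same bound in the `A(z₀, r)` normalisation of the ε-regularity theory: for every centre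
`x₀`, every time `t ∈ (0, T)` and every radius `0 < ρ ≤ S/2`,
`ρ⁻¹ ∫_{B(x₀, ρ)} |u(t)|² ≤ 2 (S⁻¹ ‖u(0)‖₂² + 4πK S²)`. [folklore] -/
theorem scaledKineticEnergy_le_of_oneSided_pressure' {ν T : ℝ} (hν : 0 ≤ ν)
    {u : ℝ → EuclideanSpace ℝ (Fin 3) → EuclideanSpace ℝ (Fin 3)}
    {p : ℝ → EuclideanSpace ℝ (Fin 3) → ℝ}
    (hsol : IsClassicalNSSolutionOn (Ico 0 T) ν 0 u p) (hLH : IsLerayHopfOn T ν 0 (u 0) u)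
    {K : ℝ} (hK : 0 ≤ K)
    (hone : (∀ t ∈ Ioo 0 T, ∀ x, ‖u t x‖ ^ 2 / 2 + normalisedPressure (u t) x ≤ K) ∨
      (∀ t ∈ Ioo 0 T, ∀ x, -K ≤ normalisedPressure (u t) x))
    {t : ℝ} (ht : t ∈ Ioo 0 T) (x₀ : EuclideanSpace ℝ (Fin 3)) {ρ S : ℝ} (hρ : 0 < ρ) (hρS : 2 * ρ ≤ S) :
    ρ⁻¹ * ∫ x in ball x₀ ρ, ‖u t x‖ ^ 2 ≤ 2 * (S⁻¹ * (∫ x, ‖u 0 x‖ ^ 2) + 4 * π * K * S ^ 2) := by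
  have h := scaledKineticEnergy_le_of_oneSided_pressure hν hsol hLH hK hone ht x₀
    (by linarith : 0 < 2 * ρ) hρS
  rw [show 2 * ρ / 2 = ρ by ring, mul_inv] at h
  have : ρ⁻¹ * ∫ x in ball x₀ ρ, ‖u t x‖ ^ 2 = 2 * (2⁻¹ * ρ⁻¹ * ∫ x in ball x₀ ρ, ‖u t x‖ ^ 2) := by
    ring
  rw [this]
  linarith

end Application

end SereginSverak2002

end Literature.Analysis.FluidPDE

end
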